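import Mathlib
import HarnessLib

/-!
# The dominated integral of Osgood and Shisha (Davis–Rabinowitz 1984, Sect. 1.6.8)

Davis–Rabinowitz, *Methods of Numerical Integration* (2nd ed., 1984), Sect. 1.6.8 (held OCR PDF pp. 17–18).
In the definition of the improper integral of an unbounded integrand on `(0, 1]` there are two limiting
processes (`I_r = ∫_r^1 f`, then `r → 0⁺`). For a certain class of unbounded integrands the improper integral
can be defined by a *single* limiting process, as the limit of suitably *restricted* Riemann sums; the concept
(Osgood and Shisha) is the **dominated integral**:

DEFINITION. The dominated integral of a function `f` defined on `(0, 1]`, if it exists, is the unique number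
`I(f)` having the property: for each `ε > 0` there exist `δ` and `χ`, `0 < δ < 1`, `0 < χ < 1`, such that
`|I(f) - Σ_{j=1}^{n} f(τ_j)(t_j - t_{j-1})| < ε` whenever `0 < t_0 < t_1 < ⋯ < t_n = 1`, `t_0 < χ`,
`t_{j-1} ≤ τ_j ≤ t_j` and `t_{j-1} t_j⁻¹ > 1 - δ`, `j = 1, …, n`.

The text then states: (i) if `I(f)` exists, the improper integral of `f` exists and equals `I(f)`; (ii) `I(f)`
exists iff `f` is Riemann integrable on each `[a, b] ⊂ (0, 1]` and there is a function `h`, monotone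
nonincreasing and improperly Riemann integrable on `(0, 1]`, with `h(t) ≥ |f(t)|` throughout `(0, 1]`
(Osgood–Shisha [1]); (iii) (Osgood–Shisha [2]) dominant integrability is equivalent to the convergence of every
sequence of integration rules "of some reasonable, natural form" ("ignoring the singularity", Sect. 2.12.7);
Haber–Shisha's *simple integral* is the `[0, ∞)` analogue.

What is formalised here (Mathlib only):

* the restricted tagged partitions of the definition (`OSPartition`: `0 < t 0 < ⋯ < t n = 1`, tags
  `τ (j+1) ∈ [t j, t (j+1)]`, no term on `(0, t 0]`), their Riemann sums `OSPartition.rsum`, the admissibility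
  condition `OSPartition.Admissible δ χ` (`t 0 < χ`, `t j / t (j+1) > 1 - δ`), and the definition itself
  (`HasDominatedIntegral`, `DominantlyIntegrable`);
* PROVED: admissible partitions exist for every `δ > 0`, `χ > 0` (geometric meshes `t j = q^{n-j}`,
  `OSPartition.exists_admissible`) — so the definition is never vacuous — and hence the number `I(f)` is
  UNIQUE (`HasDominatedIntegral.unique`, the word "unique" in the definition); constants
  (`hasDominatedIntegral_const`), linearity (`HasDominatedIntegral.add`, `.const_mul`) and monotonicity
  (`HasDominatedIntegral.le_of_le`);
* PROVED, as the worked instance of an unbounded integrand: the weight `x^{-1/2}` of Sect. 1.10 (1.10.2)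
  has dominated integral `2 = ∫_0^1 x^{-1/2} dx` (`hasDominatedIntegral_inv_sqrt`) — the ratio condition
  `t_{j-1}/t_j > 1 - δ` is exactly what controls the sums near the singularity;
* statements (i) and (ii) as NAMED FACTS (`DominatedIntegralEqImproper`, `OsgoodShishaNecessity`,
  `OsgoodShishaSufficiency`). Reading: Mathlib's interval integral is the Lebesgue one, so "Riemann integrable
  on each `[a, b]`" cannot be transcribed literally; (ii) is therefore split into its necessity half (true
  verbatim with the Lebesgue reading of "improperly integrable `h`") and its sufficiency half restricted to
  `f` continuous on `(0, 1]` (continuous functions are Riemann integrable on each `[a, 1]`); the unrestricted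
  Lebesgue reading of sufficiency would be false (the indicator of `ℚ ∩ (0, 1]` is dominated by `h = 1` but
  its restricted Riemann sums have no limit);
* PROVED (appended sections, Osgood–Shisha's original paper being unavailable to us, the arguments are our own
  reconstruction and are spelled out in the docstrings): both halves of (ii) —
  `OsgoodShishaNecessity_holds` (the least antitone majorant `sup_{[t,1]} |f|` is integrable: on a geometric
  grid of ratio `q` the definition bounds the weighted `ℓ¹` distance between any two tag families, and
  comparing left with right endpoints yields a contraction by the factor `q`, whence the cell suprema are
  weighted-summable) and `OsgoodShishaSufficiency_holds` (uniform continuity away from `0`; near `0` the cells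
  rescaled by `1 - δ` are disjoint and lie to the left of their own left endpoints, which bounds the left-endpoint
  sums of the antitone majorant by `(1-δ)⁻¹ ∫_0^χ h`);
* PROVED (last appended section): statement (i), `DominatedIntegralEqImproper_holds` — on an admissible uniform
  partition of `[v, 1]` the definition bounds the oscillation sum `Σ (sup - inf) w` by `2ε`, so `f` is squeezed
  between step functions with `L¹`-close integrals (the classical Riemann ⇒ Lebesgue mechanism,
  `integrableOn_of_squeeze`), giving integrability on every `[r, 1]`, and for `v < χ` both `I` and `∫_v^1 f` are
  close to the left-endpoint Riemann sum.

Not formalised: statement (iii) (it quantifies over an informal class of rules) and the Haber–Shisha simple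
integral on `[0, ∞)`.
-/

open Finset Set Filter Topology MeasureTheory

namespace Literature.Analysis.Quadrature

/-! ## Restricted tagged partitions and their Riemann sums -/

/-- A tagged partition of the kind used in the Osgood–Shisha definition: points
`0 < t 0 < t 1 < ⋯ < t n = 1` and tags `τ (j+1) ∈ [t j, t (j+1)]` for `j < n` (the text's `τ_j ∈ [t_{j-1}, t_j]`,
`j = 1, …, n`); the leftmost interval `(0, t 0]` carries no term of the sum.
[cite: DavisRabinowitz1984, Sect. 1.6.8] -/
structure OSPartition where
  /-- number of subintervals `[t (j-1), t j]`, `j = 1, …, n` -/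
  n : ℕ
  /-- the points `t 0, …, t n` (values at indices `> n` are irrelevant) -/
  t : ℕ → ℝ
  /-- the tags `τ 1, …, τ n` (values at other indices are irrelevant) -/
  τ : ℕ → ℝ
  t_zero_pos : 0 < t 0
  t_last : t n = 1
  t_lt_succ : ∀ j < n, t j < t (j + 1)
  tag_mem : ∀ j < n, t j ≤ τ (j + 1) ∧ τ (j + 1) ≤ t (j + 1)

namespace OSPartition

variable (P : OSPartition)

/-- The restricted Riemann sum `Σ_{j=1}^{n} f(τ_j) (t_j - t_{j-1})` of the definition (no term on `(0, t_0]`).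
[cite: DavisRabinowitz1984, Sect. 1.6.8] -/
noncomputable def rsum (f : ℝ → ℝ) : ℝ :=
  ∑ j ∈ range P.n, f (P.τ (j + 1)) * (P.t (j + 1) - P.t j)

/-- Admissibility of a partition for the parameters `(δ, χ)` of the definition: `t_0 < χ` and
`t_{j-1} t_j⁻¹ > 1 - δ` for `j = 1, …, n`. [cite: DavisRabinowitz1984, Sect. 1.6.8] -/
def Admissible (δ χ : ℝ) : Prop :=
  P.t 0 < χ ∧ ∀ j < P.n, 1 - δ < P.t j / P.t (j + 1)

/-- The points increase: `t i ≤ t j` for `i ≤ j ≤ n`. [cite: DavisRabinowitz1984, Sect. 1.6.8] -/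
theorem t_mono {i j : ℕ} (hij : i ≤ j) (hj : j ≤ P.n) : P.t i ≤ P.t j := by
  induction j with
  | zero =>
    have : i = 0 := Nat.le_zero.mp hij
    subst this; exact le_rfl
  | succ k ih =>
    rcases Nat.lt_or_eq_of_le hij with h | h
    · exact (ih (Nat.lt_succ_iff.mp h) (Nat.le_of_succ_le hj)).trans
        (le_of_lt (P.t_lt_succ k (Nat.lt_of_succ_le hj)))
    · subst h; exact le_rfl

/-- All points are positive: `0 < t j` for `j ≤ n`. [cite: DavisRabinowitz1984, Sect. 1.6.8] -/
theorem t_pos {j : ℕ} (hj : j ≤ P.n) : 0 < P.t j :=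
  lt_of_lt_of_le P.t_zero_pos (P.t_mono (Nat.zero_le j) hj)

/-- All points lie in `(0, 1]`: `t j ≤ 1` for `j ≤ n`. [cite: DavisRabinowitz1984, Sect. 1.6.8] -/
theorem t_le_one {j : ℕ} (hj : j ≤ P.n) : P.t j ≤ 1 := by
  simpa [P.t_last] using P.t_mono hj le_rfl

/-- The tags are positive. [cite: DavisRabinowitz1984, Sect. 1.6.8] -/
theorem tag_pos {j : ℕ} (hj : j < P.n) : 0 < P.τ (j + 1) :=
  lt_of_lt_of_le (P.t_pos (Nat.le_of_lt hj)) (P.tag_mem j hj).1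

/-- The tags lie in `(0, 1]`. [cite: DavisRabinowitz1984, Sect. 1.6.8] -/
theorem tag_mem_Ioc {j : ℕ} (hj : j < P.n) : P.τ (j + 1) ∈ Ioc (0 : ℝ) 1 :=
  ⟨P.tag_pos hj, (P.tag_mem j hj).2.trans (P.t_le_one (Nat.succ_le_of_lt hj))⟩

/-- The weights `t_j - t_{j-1}` are positive. [cite: DavisRabinowitz1984, Sect. 1.6.8] -/
theorem weight_pos {j : ℕ} (hj : j < P.n) : 0 < P.t (j + 1) - P.t j :=
  sub_pos.mpr (P.t_lt_succ j hj)

/-- The sum of the weights telescopes to `t_n - t_0 = 1 - t_0` (the piece `(0, t_0]` is ignored).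
[cite: DavisRabinowitz1984, Sect. 1.6.8] -/
theorem sum_weights : ∑ j ∈ range P.n, (P.t (j + 1) - P.t j) = 1 - P.t 0 := by
  rw [Finset.sum_range_sub, P.t_last]

/-- The restricted Riemann sum of a constant: `c (1 - t_0)`. [cite: DavisRabinowitz1984, Sect. 1.6.8] -/
theorem rsum_const (c : ℝ) : P.rsum (fun _ => c) = c * (1 - P.t 0) := by
  simp only [rsum, ← Finset.mul_sum, P.sum_weights]

/-- Additivity of the restricted Riemann sums. [cite: DavisRabinowitz1984, Sect. 1.6.8] -/
theorem rsum_add (f g : ℝ → ℝ) : P.rsum (fun x => f x + g x) = P.rsum f + P.rsum g := by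
  simp only [rsum, add_mul, Finset.sum_add_distrib]

/-- Homogeneity of the restricted Riemann sums. [cite: DavisRabinowitz1984, Sect. 1.6.8] -/
theorem rsum_const_mul (c : ℝ) (f : ℝ → ℝ) : P.rsum (fun x => c * f x) = c * P.rsum f := by
  simp only [rsum, Finset.mul_sum, mul_assoc]

/-- Monotonicity of the restricted Riemann sums in the integrand (the weights are positive and the tags lie in
`(0, 1]`). [cite: DavisRabinowitz1984, Sect. 1.6.8] -/
theorem rsum_mono {f g : ℝ → ℝ} (h : ∀ x ∈ Ioc (0 : ℝ) 1, f x ≤ g x) : P.rsum f ≤ P.rsum g := by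
  unfold rsum
  refine Finset.sum_le_sum fun j hj => ?_
  have hj' : j < P.n := Finset.mem_range.mp hj
  exact mul_le_mul_of_nonneg_right (h _ (P.tag_mem_Ioc hj')) (le_of_lt (P.weight_pos hj'))

/-- Admissibility is monotone in the parameters. [cite: DavisRabinowitz1984, Sect. 1.6.8] -/
theorem Admissible.mono {P : OSPartition} {δ χ δ' χ' : ℝ} (h : P.Admissible δ χ) (hδ : δ ≤ δ') (hχ : χ ≤ χ') :
    P.Admissible δ' χ' :=
  ⟨lt_of_lt_of_le h.1 hχ, fun j hj => lt_of_le_of_lt (by linarith) (h.2 j hj)⟩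

/-- **Admissible partitions exist** for every `δ > 0` and `χ > 0`: a geometric mesh `t j = q^{n-j}` with
`1 - δ < q < 1` (and `q^n < χ`), tagged at the right endpoints, has all ratios `t_{j-1}/t_j = q`. Hence the
definition of the dominated integral is never vacuously satisfied. [cite: DavisRabinowitz1984, Sect. 1.6.8] -/
theorem exists_admissible {δ χ : ℝ} (hδ : 0 < δ) (hχ : 0 < χ) : ∃ P : OSPartition, P.Admissible δ χ := by
  set q : ℝ := max (1 - δ / 2) (1 / 2) with hq_def
  have hq_pos : 0 < q := lt_of_lt_of_le (by norm_num) (le_max_right _ _)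
  have hq_lt_one : q < 1 := max_lt (by linarith) (by norm_num)
  have hq_gt : 1 - δ < q := lt_of_lt_of_le (by linarith) (le_max_left _ _)
  obtain ⟨N, hN⟩ := exists_pow_lt_of_lt_one hχ hq_lt_one
  refine ⟨{ n := N, t := fun j => q ^ (N - j), τ := fun j => q ^ (N - j),
            t_zero_pos := by positivity,
            t_last := by simp,
            t_lt_succ := fun j hj => ?_,
            tag_mem := fun j hj => ⟨?_, le_rfl⟩ }, ?_, fun j hj => ?_⟩
  · exact pow_lt_pow_right_of_lt_one₀ hq_pos hq_lt_one (by omega)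
  · exact pow_le_pow_of_le_one hq_pos.le hq_lt_one.le (by omega)
  · simpa using hN
  · show 1 - δ < q ^ (N - j) / q ^ (N - (j + 1))
    have hjN : j < N := hj
    have : N - j = (N - (j + 1)) + 1 := by omega
    rw [this, pow_succ, mul_div_cancel_left₀ _ (pow_ne_zero _ hq_pos.ne')]
    exact hq_gt

end OSPartition

/-! ## The definition -/

/-- **The dominated integral** (Osgood–Shisha): `I` is the dominated integral of `f` on `(0, 1]` iff for
every `ε > 0` there are `δ, χ ∈ (0, 1)` such that every admissible restricted Riemann sum is within `ε` of `I`.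
[cite: DavisRabinowitz1984, Sect. 1.6.8] -/
def HasDominatedIntegral (f : ℝ → ℝ) (I : ℝ) : Prop :=
  ∀ ε > 0, ∃ δ χ : ℝ, 0 < δ ∧ δ < 1 ∧ 0 < χ ∧ χ < 1 ∧
    ∀ P : OSPartition, P.Admissible δ χ → |I - P.rsum f| < ε

/-- `f` is **dominantly integrable** on `(0, 1]` iff its dominated integral exists.
[cite: DavisRabinowitz1984, Sect. 1.6.8] -/
def DominantlyIntegrable (f : ℝ → ℝ) : Prop :=
  ∃ I : ℝ, HasDominatedIntegral f I

/-- The word "unique" in the definition is justified: admissible partitions exist for all parameters, so two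
dominated integrals of the same function coincide. [cite: DavisRabinowitz1984, Sect. 1.6.8] -/
theorem HasDominatedIntegral.unique {f : ℝ → ℝ} {I J : ℝ} (hI : HasDominatedIntegral f I)
    (hJ : HasDominatedIntegral f J) : I = J := by
  by_contra hne
  have hε : 0 < |I - J| / 2 := by
    have : 0 < |I - J| := abs_pos.mpr (sub_ne_zero.mpr hne)
    linarith
  obtain ⟨δ₁, χ₁, hδ₁, -, hχ₁, -, h₁⟩ := hI _ hε
  obtain ⟨δ₂, χ₂, hδ₂, -, hχ₂, -, h₂⟩ := hJ _ hε
  obtain ⟨P, hP⟩ := OSPartition.exists_admissible (lt_min hδ₁ hδ₂) (lt_min hχ₁ hχ₂)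
  have e₁ := h₁ P (hP.mono (min_le_left _ _) (min_le_left _ _))
  have e₂ := h₂ P (hP.mono (min_le_right _ _) (min_le_right _ _))
  have : |I - J| < |I - J| := by
    calc |I - J| = |(I - P.rsum f) - (J - P.rsum f)| := by ring_nf
      _ ≤ |I - P.rsum f| + |J - P.rsum f| := abs_sub _ _
      _ < |I - J| / 2 + |I - J| / 2 := add_lt_add e₁ e₂
      _ = |I - J| := by ring
  exact lt_irrefl _ this

/-- Constants are dominantly integrable with `I(c) = c`: the sums are `c (1 - t_0)` and `t_0 < χ` is small.
[cite: DavisRabinowitz1984, Sect. 1.6.8] -/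
theorem hasDominatedIntegral_const (c : ℝ) : HasDominatedIntegral (fun _ => c) c := by
  intro ε hε
  have hc : 0 < |c| + 1 := by positivity
  refine ⟨1 / 2, min (1 / 2) (ε / (|c| + 1)), by norm_num, by norm_num,
    lt_min (by norm_num) (div_pos hε hc), lt_of_le_of_lt (min_le_left _ _) (by norm_num), fun P hP => ?_⟩
  rw [P.rsum_const]
  have ht0 : 0 < P.t 0 := P.t_zero_pos
  have ht : P.t 0 < ε / (|c| + 1) := lt_of_lt_of_le hP.1 (min_le_right _ _)
  calc |c - c * (1 - P.t 0)| = |c| * P.t 0 := by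
        rw [show c - c * (1 - P.t 0) = c * P.t 0 by ring, abs_mul, abs_of_pos ht0]
    _ ≤ |c| * (ε / (|c| + 1)) := mul_le_mul_of_nonneg_left ht.le (abs_nonneg c)
    _ < ε := by
        rw [mul_div_assoc']
        rw [div_lt_iff₀ hc]
        nlinarith [abs_nonneg c]

/-- Linearity (sum). [cite: DavisRabinowitz1984, Sect. 1.6.8] -/
theorem HasDominatedIntegral.add {f g : ℝ → ℝ} {I J : ℝ} (hf : HasDominatedIntegral f I)
    (hg : HasDominatedIntegral g J) : HasDominatedIntegral (fun x => f x + g x) (I + J) := by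
  intro ε hε
  obtain ⟨δ₁, χ₁, hδ₁, hδ₁', hχ₁, hχ₁', h₁⟩ := hf (ε / 2) (half_pos hε)
  obtain ⟨δ₂, χ₂, hδ₂, -, hχ₂, -, h₂⟩ := hg (ε / 2) (half_pos hε)
  refine ⟨min δ₁ δ₂, min χ₁ χ₂, lt_min hδ₁ hδ₂, lt_of_le_of_lt (min_le_left _ _) hδ₁', lt_min hχ₁ hχ₂,
    lt_of_le_of_lt (min_le_left _ _) hχ₁', fun P hP => ?_⟩
  have e₁ := h₁ P (hP.mono (min_le_left _ _) (min_le_left _ _))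
  have e₂ := h₂ P (hP.mono (min_le_right _ _) (min_le_right _ _))
  rw [P.rsum_add, abs_lt]
  rw [abs_lt] at e₁ e₂
  constructor <;> linarith [e₁.1, e₁.2, e₂.1, e₂.2]

/-- Linearity (scalar multiple). [cite: DavisRabinowitz1984, Sect. 1.6.8] -/
theorem HasDominatedIntegral.const_mul {f : ℝ → ℝ} {I : ℝ} (c : ℝ) (hf : HasDominatedIntegral f I) :
    HasDominatedIntegral (fun x => c * f x) (c * I) := by
  rcases eq_or_ne c 0 with rfl | hc
  · simpa using hasDominatedIntegral_const 0
  intro ε hε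
  have hc' : 0 < |c| := abs_pos.mpr hc
  obtain ⟨δ, χ, hδ, hδ', hχ, hχ', h⟩ := hf (ε / |c|) (div_pos hε hc')
  refine ⟨δ, χ, hδ, hδ', hχ, hχ', fun P hP => ?_⟩
  rw [P.rsum_const_mul, ← mul_sub, abs_mul]
  calc |c| * |I - P.rsum f| < |c| * (ε / |c|) := mul_lt_mul_of_pos_left (h P hP) hc'
    _ = ε := by field_simp

/-- Monotonicity: if `f ≤ g` on `(0, 1]` and both dominated integrals exist, then `I(f) ≤ I(g)`.
[cite: DavisRabinowitz1984, Sect. 1.6.8] -/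
theorem HasDominatedIntegral.le_of_le {f g : ℝ → ℝ} {I J : ℝ} (hf : HasDominatedIntegral f I)
    (hg : HasDominatedIntegral g J) (h : ∀ x ∈ Ioc (0 : ℝ) 1, f x ≤ g x) : I ≤ J := by
  refine not_lt.mp fun hlt => ?_
  have hε : 0 < (I - J) / 2 := by linarith
  obtain ⟨δ₁, χ₁, hδ₁, -, hχ₁, -, h₁⟩ := hf _ hε
  obtain ⟨δ₂, χ₂, hδ₂, -, hχ₂, -, h₂⟩ := hg _ hε
  obtain ⟨P, hP⟩ := OSPartition.exists_admissible (lt_min hδ₁ hδ₂) (lt_min hχ₁ hχ₂)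
  have e₁ := h₁ P (hP.mono (min_le_left _ _) (min_le_left _ _))
  have e₂ := h₂ P (hP.mono (min_le_right _ _) (min_le_right _ _))
  have hmono := P.rsum_mono h
  rw [abs_lt] at e₁ e₂
  linarith [e₁.1, e₁.2, e₂.1, e₂.2]

/-! ## The worked unbounded instance: `x^{-1/2}` -/

/-- Square-root factorisation of a weight: `b - a = (√b - √a)(√b + √a)` for `a, b ≥ 0`. [folklore] -/
private theorem sub_eq_sqrt_mul {a b : ℝ} (ha : 0 ≤ a) (hb : 0 ≤ b) :
    b - a = (Real.sqrt b - Real.sqrt a) * (Real.sqrt b + Real.sqrt a) := by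
  nlinarith [Real.mul_self_sqrt ha, Real.mul_self_sqrt hb]

/-- The ratio condition controls square roots: if `0 < a ≤ b`, `(1 - δ) b < a` and `0 ≤ δ ≤ 1/2`, then
`(1 - δ) √b ≤ √a` and `√b ≤ (1 + δ) √a`. [folklore] -/
private theorem sqrt_bounds_of_ratio {a b δ : ℝ} (ha : 0 < a) (hab : a ≤ b) (hr : (1 - δ) * b < a)
    (hδ : 0 ≤ δ) (hδ' : δ ≤ 1 / 2) :
    (1 - δ) * Real.sqrt b ≤ Real.sqrt a ∧ Real.sqrt b ≤ (1 + δ) * Real.sqrt a := by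
  have hb : 0 < b := lt_of_lt_of_le ha hab
  have h1δ : 0 ≤ 1 - δ := by linarith
  constructor
  · -- (1-δ)√b = √((1-δ)² b) ≤ √a since (1-δ)² b ≤ (1-δ) b < a
    have : (1 - δ) * Real.sqrt b = Real.sqrt ((1 - δ) ^ 2 * b) := by
      rw [Real.sqrt_mul (by positivity), Real.sqrt_sq h1δ]
    rw [this]
    apply Real.sqrt_le_sqrt
    nlinarith
  · -- √b ≤ √((1+δ)² a) = (1+δ)√a since b < a/(1-δ) ≤ (1+δ)² a (uses δ ≤ 1/2)
    have : (1 + δ) * Real.sqrt a = Real.sqrt ((1 + δ) ^ 2 * a) := by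
      rw [Real.sqrt_mul (by positivity), Real.sqrt_sq (by linarith)]
    rw [this]
    apply Real.sqrt_le_sqrt
    -- (1+δ)²(1-δ) ≥ 1 for 0 ≤ δ ≤ 1/2, so (1+δ)² a > (1+δ)²(1-δ) b ≥ b
    nlinarith [mul_nonneg hδ hδ, mul_nonneg (mul_nonneg hδ hδ) hb.le, mul_nonneg hδ hb.le]

/-- **The weight `x^{-1/2}` has dominated integral `2`** (`= ∫_0^1 x^{-1/2} dx`, Sect. 1.10 (1.10.2)): for an
admissible partition the restricted Riemann sums of `1/√x` lie between `(2 - δ)(1 - √t_0)` and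
`(2 + δ)(1 - √t_0)` (the ratio condition `t_{j-1}/t_j > 1 - δ` pins `√τ_j` against `√t_{j-1}`, `√t_j`, and
`t_j - t_{j-1} = (√t_j - √t_{j-1})(√t_j + √t_{j-1})` telescopes), whence `|2 - Σ| ≤ 2√t_0 + δ < 2√χ + δ`.
[cite: DavisRabinowitz1984, Sect. 1.6.8] -/
theorem hasDominatedIntegral_inv_sqrt : HasDominatedIntegral (fun x => (Real.sqrt x)⁻¹) 2 := by
  intro ε hε
  refine ⟨min (1 / 2) (ε / 4), min (1 / 2) ((ε / 4) ^ 2), lt_min (by norm_num) (by positivity),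
    lt_of_le_of_lt (min_le_left _ _) (by norm_num), lt_min (by norm_num) (by positivity),
    lt_of_le_of_lt (min_le_left _ _) (by norm_num), fun P hP => ?_⟩
  set δ : ℝ := min (1 / 2) (ε / 4) with hδ_def
  have hδ0 : 0 ≤ δ := le_min (by norm_num) (by positivity)
  have hδhalf : δ ≤ 1 / 2 := min_le_left _ _
  have hδε : δ ≤ ε / 4 := min_le_right _ _
  -- abbreviations
  set s : ℕ → ℝ := fun j => Real.sqrt (P.t j) with hs_def
  have hs_last : s P.n = 1 := by simp [hs_def, P.t_last]
  have hs0_nonneg : 0 ≤ s 0 := Real.sqrt_nonneg _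
  -- √t_0 < ε/4
  have hs0 : s 0 < ε / 4 := by
    have h1 : P.t 0 < (ε / 4) ^ 2 := lt_of_lt_of_le hP.1 (min_le_right _ _)
    calc s 0 = Real.sqrt (P.t 0) := rfl
      _ < Real.sqrt ((ε / 4) ^ 2) := Real.sqrt_lt_sqrt P.t_zero_pos.le h1
      _ = ε / 4 := Real.sqrt_sq (by positivity)
  -- per-term two-sided bounds
  have key : ∀ j ∈ range P.n,
      (2 - δ) * (s (j + 1) - s j) ≤ (Real.sqrt (P.τ (j + 1)))⁻¹ * (P.t (j + 1) - P.t j) ∧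
      (Real.sqrt (P.τ (j + 1)))⁻¹ * (P.t (j + 1) - P.t j) ≤ (2 + δ) * (s (j + 1) - s j) := by
    intro j hj
    have hj' : j < P.n := Finset.mem_range.mp hj
    have htj : 0 < P.t j := P.t_pos hj'.le
    have htj1 : P.t j < P.t (j + 1) := P.t_lt_succ j hj'
    obtain ⟨hτl, hτu⟩ := P.tag_mem j hj'
    have hτpos : 0 < P.τ (j + 1) := lt_of_lt_of_le htj hτl
    have hratio : (1 - δ) * P.t (j + 1) < P.t j := by
      have := hP.2 j hj'
      rwa [lt_div_iff₀ (htj.trans htj1)] at this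
    obtain ⟨hlow, hup⟩ := sqrt_bounds_of_ratio htj htj1.le hratio hδ0 hδhalf
    -- √τ between √t_j and √t_{j+1}
    have hστl : s j ≤ Real.sqrt (P.τ (j + 1)) := Real.sqrt_le_sqrt hτl
    have hστu : Real.sqrt (P.τ (j + 1)) ≤ s (j + 1) := Real.sqrt_le_sqrt hτu
    have hσpos : 0 < Real.sqrt (P.τ (j + 1)) := Real.sqrt_pos.mpr hτpos
    have hsj_pos : 0 < s j := Real.sqrt_pos.mpr htj
    have hd : 0 ≤ s (j + 1) - s j := sub_nonneg.mpr (Real.sqrt_le_sqrt htj1.le)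
    have hfact : P.t (j + 1) - P.t j = (s (j + 1) - s j) * (s (j + 1) + s j) :=
      sub_eq_sqrt_mul htj.le (htj.trans htj1).le
    rw [hfact, inv_mul_eq_div]
    constructor
    · -- (2-δ) d ≤ d (s_{j+1}+s_j)/√τ  ⇐  (2-δ) √τ ≤ s_{j+1} + s_j  ⇐  (1-δ) s_{j+1} ≤ s_j, √τ ≤ s_{j+1}
      rw [le_div_iff₀ hσpos]
      have : (2 - δ) * Real.sqrt (P.τ (j + 1)) ≤ s (j + 1) + s j := by nlinarith
      calc (2 - δ) * (s (j + 1) - s j) * Real.sqrt (P.τ (j + 1))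
          = (s (j + 1) - s j) * ((2 - δ) * Real.sqrt (P.τ (j + 1))) := by ring
        _ ≤ (s (j + 1) - s j) * (s (j + 1) + s j) := mul_le_mul_of_nonneg_left this hd
    · -- d (s_{j+1}+s_j)/√τ ≤ (2+δ) d  ⇐  s_{j+1} + s_j ≤ (2+δ) √τ  ⇐  s_{j+1} ≤ (1+δ) s_j, s_j ≤ √τ
      rw [div_le_iff₀ hσpos]
      have : s (j + 1) + s j ≤ (2 + δ) * Real.sqrt (P.τ (j + 1)) := by nlinarith
      calc (s (j + 1) - s j) * (s (j + 1) + s j)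
          ≤ (s (j + 1) - s j) * ((2 + δ) * Real.sqrt (P.τ (j + 1))) := mul_le_mul_of_nonneg_left this hd
        _ = (2 + δ) * (s (j + 1) - s j) * Real.sqrt (P.τ (j + 1)) := by ring
  -- sum the bounds; Σ (s_{j+1} - s_j) = 1 - s_0
  have htel : ∑ j ∈ range P.n, (s (j + 1) - s j) = 1 - s 0 := by
    rw [Finset.sum_range_sub, hs_last]
  have hlow : (2 - δ) * (1 - s 0) ≤ P.rsum (fun x => (Real.sqrt x)⁻¹) := by
    rw [← htel, Finset.mul_sum]
    exact Finset.sum_le_sum fun j hj => (key j hj).1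
  have hup : P.rsum (fun x => (Real.sqrt x)⁻¹) ≤ (2 + δ) * (1 - s 0) := by
    rw [← htel, Finset.mul_sum]
    exact Finset.sum_le_sum fun j hj => (key j hj).2
  have hs0_le_one : s 0 ≤ 1 := by
    have := P.t_le_one (Nat.zero_le _)
    calc s 0 = Real.sqrt (P.t 0) := rfl
      _ ≤ Real.sqrt 1 := Real.sqrt_le_sqrt this
      _ = 1 := Real.sqrt_one
  rw [abs_lt]
  constructor <;> nlinarith

/-! ## The statements of the text as named facts -/

/-- **(i) "If `I(f)` exists, then the improper integral of `f` exists and equals `I(f)`"** — with the improper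
integral `∫_{0⁺}^1 f = lim_{r → 0⁺} ∫_r^1 f` read through Mathlib's (Lebesgue) interval integral. Named fact
(Osgood–Shisha [1]); PROVED below as `DominatedIntegralEqImproper_holds`. [cite: DavisRabinowitz1984, Sect. 1.6.8] -/
def DominatedIntegralEqImproper (f : ℝ → ℝ) (I : ℝ) : Prop :=
  HasDominatedIntegral f I →
    (∀ r ∈ Ioo (0 : ℝ) 1, IntervalIntegrable f volume r 1) ∧
      Tendsto (fun r : ℝ => ∫ x in r..1, f x) (𝓝[>] 0) (𝓝 I)

/-- **(ii), necessity half**: if `I(f)` exists then `|f|` is dominated on `(0, 1]` by a monotone nonincreasing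
function `h` which is improperly integrable on `(0, 1]` (`lim_{r → 0⁺} ∫_r^1 h` exists). Named fact
(Osgood–Shisha [1]); PROVED below as `OsgoodShishaNecessity_holds`. [cite: DavisRabinowitz1984, Sect. 1.6.8] -/
def OsgoodShishaNecessity (f : ℝ → ℝ) : Prop :=
  DominantlyIntegrable f →
    ∃ h : ℝ → ℝ, AntitoneOn h (Ioc 0 1) ∧ (∀ t ∈ Ioc (0 : ℝ) 1, |f t| ≤ h t) ∧
      ∃ J : ℝ, Tendsto (fun r : ℝ => ∫ x in r..1, h x) (𝓝[>] 0) (𝓝 J)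

/-- **(ii), sufficiency half (continuous case)**: a function continuous on `(0, 1]` (hence Riemann integrable
on each `[a, b] ⊂ (0, 1]`, as the text requires) which is dominated by a monotone nonincreasing, improperly
integrable `h` is dominantly integrable. Named fact (Osgood–Shisha [1]), PROVED below as
`OsgoodShishaSufficiency_holds`; see the module docstring for why the text's "Riemann integrable on each
`[a, b]`" is specialised to continuity. [cite: DavisRabinowitz1984, Sect. 1.6.8] -/
def OsgoodShishaSufficiency (f : ℝ → ℝ) : Prop :=
  ContinuousOn f (Ioc 0 1) →
    (∃ h : ℝ → ℝ, AntitoneOn h (Ioc 0 1) ∧ (∀ t ∈ Ioc (0 : ℝ) 1, |f t| ≤ h t) ∧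
      ∃ J : ℝ, Tendsto (fun r : ℝ => ∫ x in r..1, h x) (𝓝[>] 0) (𝓝 J)) →
    DominantlyIntegrable f

/-- The hypotheses of the sufficiency half are met by the worked instance: `x^{-1/2}` is continuous on
`(0, 1]`, is its own antitone dominating function there, and `∫_r^1 x^{-1/2} dx = 2 - 2√r → 2`; consistently,
`hasDominatedIntegral_inv_sqrt` PROVES the conclusion directly. Here: the domination and antitonicity.
[cite: DavisRabinowitz1984, Sect. 1.6.8] -/
theorem inv_sqrt_antitoneOn_and_dominated :
    AntitoneOn (fun x : ℝ => (Real.sqrt x)⁻¹) (Ioc 0 1) ∧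
      ∀ t ∈ Ioc (0 : ℝ) 1, |(Real.sqrt t)⁻¹| ≤ (Real.sqrt t)⁻¹ := by
  constructor
  · intro x hx y hy hxy
    have hx' : 0 < Real.sqrt x := Real.sqrt_pos.mpr hx.1
    exact inv_anti₀ hx' (Real.sqrt_le_sqrt hxy)
  · intro t ht
    rw [abs_of_nonneg (inv_nonneg.mpr (Real.sqrt_nonneg t))]

/-- Dominant integrability of the worked instance, packaged. [cite: DavisRabinowitz1984, Sect. 1.6.8] -/
theorem dominantlyIntegrable_inv_sqrt : DominantlyIntegrable (fun x => (Real.sqrt x)⁻¹) :=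
  ⟨2, hasDominatedIntegral_inv_sqrt⟩

/-! # Appendix: proofs of the Osgood–Shisha statements (ii) -/

namespace OSPartition

/-! ## Geometric partitions with prescribed tags -/

/-- The geometric partition `t j = q^{N-j}` (`j = 0, …, N`) of `[q^N, 1]`, tagged in the cell
`[q^{k+1}, q^k]` at a prescribed point `x k`. [cite: DavisRabinowitz1984, Sect. 1.6.8] -/
def geom (q : ℝ) (hq0 : 0 < q) (hq1 : q < 1) (N : ℕ) (x : ℕ → ℝ)
    (hx : ∀ k < N, q ^ (k + 1) ≤ x k ∧ x k ≤ q ^ k) : OSPartition where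
  n := N
  t := fun j => q ^ (N - j)
  τ := fun i => x (N - i)
  t_zero_pos := by positivity
  t_last := by simp
  t_lt_succ := fun j hj => pow_lt_pow_right_of_lt_one₀ hq0 hq1 (by omega)
  tag_mem := fun j hj => by
    have hk : N - (j + 1) < N := by omega
    obtain ⟨h1, h2⟩ := hx (N - (j + 1)) hk
    have e : N - j = (N - (j + 1)) + 1 := by omega
    refine ⟨?_, h2⟩
    rw [e]
    exact h1

variable {q : ℝ} (hq0 : 0 < q) (hq1 : q < 1) (N : ℕ) (x : ℕ → ℝ)
    (hx : ∀ k < N, q ^ (k + 1) ≤ x k ∧ x k ≤ q ^ k)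

/-- The leftmost point of the geometric partition is `q^N`. [cite: DavisRabinowitz1984, Sect. 1.6.8] -/
theorem geom_t_zero : (geom q hq0 hq1 N x hx).t 0 = q ^ N := by
  simp [geom]

/-- The geometric partition is admissible for `(δ, χ)` as soon as `q^N < χ` and `1 - δ < q`.
[cite: DavisRabinowitz1984, Sect. 1.6.8] -/
theorem geom_admissible {δ χ : ℝ} (hχ : q ^ N < χ) (hδ : 1 - δ < q) :
    (geom q hq0 hq1 N x hx).Admissible δ χ := by
  refine ⟨by simpa [geom] using hχ, fun j hj => ?_⟩
  have hjN : j < N := hj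
  show 1 - δ < q ^ (N - j) / q ^ (N - (j + 1))
  have : N - j = (N - (j + 1)) + 1 := by omega
  rw [this, pow_succ, mul_div_cancel_left₀ _ (pow_ne_zero _ hq0.ne')]
  exact hδ

/-- The restricted Riemann sum over the geometric partition, indexed by cells `[q^{k+1}, q^k]`:
`Σ_{k<N} f(x_k) q^k (1 - q)`. [cite: DavisRabinowitz1984, Sect. 1.6.8] -/
theorem geom_rsum (f : ℝ → ℝ) :
    (geom q hq0 hq1 N x hx).rsum f = ∑ k ∈ range N, f (x k) * (q ^ k * (1 - q)) := by
  rw [← Finset.sum_range_reflect (fun k => f (x k) * (q ^ k * (1 - q))) N]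
  unfold rsum
  refine Finset.sum_congr rfl fun j hj => ?_
  have hj' : j < N := mem_range.mp hj
  have e1 : N - (j + 1) = N - 1 - j := by omega
  have e2 : N - j = (N - 1 - j) + 1 := by omega
  simp only [geom]
  rw [e1, e2, pow_succ]
  ring

end OSPartition

/-! ## Consequences of the definition on geometric grids -/

section Grid

variable {f : ℝ → ℝ} {I ε δ χ q : ℝ}

/-- **Two tag families.** If every `(δ, χ)`-admissible sum is within `ε` of `I`, then on a geometric grid of
ratio `q > 1 - δ` reaching below `χ`, the values of `f` at two tag families differ, in the weighted `ℓ¹` sense,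
by less than `2ε` (swap the tags cell by cell so that every difference has the same sign).
[cite: DavisRabinowitz1984, Sect. 1.6.8] -/
theorem sum_abs_sub_mul_lt_of_pow_lt (hq0 : 0 < q) (hq1 : q < 1) (hδq : 1 - δ < q)
    (hI : ∀ P : OSPartition, P.Admissible δ χ → |I - P.rsum f| < ε) {N : ℕ} (hN : q ^ N < χ)
    {x y : ℕ → ℝ} (hx : ∀ k < N, q ^ (k + 1) ≤ x k ∧ x k ≤ q ^ k)
    (hy : ∀ k < N, q ^ (k + 1) ≤ y k ∧ y k ≤ q ^ k) :
    ∑ k ∈ range N, |f (x k) - f (y k)| * (q ^ k * (1 - q)) < 2 * ε := by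
  classical
  set u : ℕ → ℝ := fun k => if f (y k) ≤ f (x k) then x k else y k with hu_def
  set v : ℕ → ℝ := fun k => if f (y k) ≤ f (x k) then y k else x k with hv_def
  have hu : ∀ k < N, q ^ (k + 1) ≤ u k ∧ u k ≤ q ^ k := fun k hk => by
    simp only [hu_def]
    split_ifs
    exacts [hx k hk, hy k hk]
  have hv : ∀ k < N, q ^ (k + 1) ≤ v k ∧ v k ≤ q ^ k := fun k hk => by
    simp only [hv_def]
    split_ifs
    exacts [hy k hk, hx k hk]
  have huv : ∀ k, |f (x k) - f (y k)| = f (u k) - f (v k) := fun k => by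
    simp only [hu_def, hv_def]
    split_ifs with h
    · exact abs_of_nonneg (sub_nonneg.mpr h)
    · rw [abs_sub_comm]
      exact abs_of_nonneg (sub_nonneg.mpr (le_of_lt (not_le.mp h)))
  have h1 := hI _ (OSPartition.geom_admissible hq0 hq1 N u hu hN hδq)
  have h2 := hI _ (OSPartition.geom_admissible hq0 hq1 N v hv hN hδq)
  rw [OSPartition.geom_rsum] at h1 h2
  set Su := ∑ k ∈ range N, f (u k) * (q ^ k * (1 - q)) with hSu
  set Sv := ∑ k ∈ range N, f (v k) * (q ^ k * (1 - q)) with hSv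
  calc ∑ k ∈ range N, |f (x k) - f (y k)| * (q ^ k * (1 - q))
      = ∑ k ∈ range N, (f (u k) - f (v k)) * (q ^ k * (1 - q)) :=
        Finset.sum_congr rfl fun k _ => by rw [huv]
    _ = Su - Sv := by
        rw [hSu, hSv, ← Finset.sum_sub_distrib]
        refine Finset.sum_congr rfl fun k _ => by ring
    _ ≤ |Su - Sv| := le_abs_self _
    _ = |(I - Sv) - (I - Su)| := by ring_nf
    _ ≤ |I - Sv| + |I - Su| := abs_sub _ _
    _ < ε + ε := add_lt_add h2 h1
    _ = 2 * ε := by ring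

/-- The same bound for a grid of any depth `N` (extend the tags by right endpoints down to below `χ`;
the added cells contribute nothing). [cite: DavisRabinowitz1984, Sect. 1.6.8] -/
theorem sum_abs_sub_mul_lt (hq0 : 0 < q) (hq1 : q < 1) (hδq : 1 - δ < q) (hχ : 0 < χ)
    (hI : ∀ P : OSPartition, P.Admissible δ χ → |I - P.rsum f| < ε) (N : ℕ)
    {x y : ℕ → ℝ} (hx : ∀ k < N, q ^ (k + 1) ≤ x k ∧ x k ≤ q ^ k)
    (hy : ∀ k < N, q ^ (k + 1) ≤ y k ∧ y k ≤ q ^ k) :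
    ∑ k ∈ range N, |f (x k) - f (y k)| * (q ^ k * (1 - q)) < 2 * ε := by
  classical
  obtain ⟨N₀, hN₀⟩ := exists_pow_lt_of_lt_one hχ hq1
  set N' := max N N₀ with hN'
  have hN'χ : q ^ N' < χ :=
    lt_of_le_of_lt (pow_le_pow_of_le_one hq0.le hq1.le (le_max_right _ _)) hN₀
  set x' : ℕ → ℝ := fun k => if k < N then x k else q ^ k with hx'
  set y' : ℕ → ℝ := fun k => if k < N then y k else q ^ k with hy'
  have hend : ∀ k, q ^ (k + 1) ≤ q ^ k ∧ q ^ k ≤ q ^ k := fun k =>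
    ⟨pow_le_pow_of_le_one hq0.le hq1.le (Nat.le_succ k), le_rfl⟩
  have hx'v : ∀ k < N', q ^ (k + 1) ≤ x' k ∧ x' k ≤ q ^ k := fun k _ => by
    simp only [hx']
    split_ifs with h
    exacts [hx k h, hend k]
  have hy'v : ∀ k < N', q ^ (k + 1) ≤ y' k ∧ y' k ≤ q ^ k := fun k _ => by
    simp only [hy']
    split_ifs with h
    exacts [hy k h, hend k]
  have key := sum_abs_sub_mul_lt_of_pow_lt hq0 hq1 hδq hI hN'χ hx'v hy'v
  have hsub : range N ⊆ range N' := range_subset_range.mpr (le_max_left _ _)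
  calc ∑ k ∈ range N, |f (x k) - f (y k)| * (q ^ k * (1 - q))
      = ∑ k ∈ range N, |f (x' k) - f (y' k)| * (q ^ k * (1 - q)) :=
        Finset.sum_congr rfl fun k hk => by
          have hk' : k < N := mem_range.mp hk
          simp only [hx', hy', if_pos hk']
    _ ≤ ∑ k ∈ range N', |f (x' k) - f (y' k)| * (q ^ k * (1 - q)) := by
        refine Finset.sum_le_sum_of_subset_of_nonneg hsub fun k _ _ => ?_
        exact mul_nonneg (abs_nonneg _) (mul_nonneg (pow_nonneg hq0.le _) (by linarith))
    _ < 2 * ε := key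

end Grid

/-! ## Necessity: a dominantly integrable function has an integrable antitone majorant -/

section Necessity

variable {f : ℝ → ℝ} {ε q : ℝ}

/-- **Contraction step.** On a geometric grid, if right and left endpoint values are `ℓ¹`-close in the sense
of `sum_abs_sub_mul_lt`, then the weighted endpoint values `|f(q^k)| q^k (1-q)` are summable with an explicit
bound: `|f(q^{k+1})| q^{k+1} ≤ q · |f(q^k)| q^k + (error)`, a contraction by the factor `q < 1`.
[cite: DavisRabinowitz1984, Sect. 1.6.8] -/
theorem sum_abs_endpoint_mul_le (hq0 : 0 < q) (hq1 : q < 1)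
    (hA : ∀ N : ℕ, ∑ k ∈ range N, |f (q ^ k) - f (q ^ (k + 1))| * (q ^ k * (1 - q)) < 2 * ε)
    (N : ℕ) : ∑ k ∈ range N, |f (q ^ k)| * (q ^ k * (1 - q)) ≤ |f 1| + 2 * ε * q / (1 - q) := by
  have h1q : 0 < 1 - q := by linarith
  set A : ℕ → ℝ := fun N => ∑ k ∈ range N, |f (q ^ k)| * q ^ k with hA_def
  have hA_nonneg : ∀ k : ℕ, 0 ≤ |f (q ^ k)| * q ^ k := fun k =>
    mul_nonneg (abs_nonneg _) (pow_nonneg hq0.le _)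
  have hmono : A N ≤ A (N + 1) := by
    simp only [hA_def]
    exact Finset.sum_le_sum_of_subset_of_nonneg (range_subset_range.mpr (Nat.le_succ N))
      fun k _ _ => hA_nonneg k
  -- the recursion `A (N+1) ≤ |f 1| + q A N + 2 ε q / (1 - q)`
  have hrec : A (N + 1) ≤ |f 1| + q * A N + 2 * ε * q / (1 - q) := by
    have hstep : ∀ k, |f (q ^ (k + 1))| * q ^ (k + 1) ≤
        q * (|f (q ^ k)| * q ^ k) + q / (1 - q) * (|f (q ^ k) - f (q ^ (k + 1))| * (q ^ k * (1 - q))) := by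
      intro k
      have htri : |f (q ^ (k + 1))| ≤ |f (q ^ k)| + |f (q ^ k) - f (q ^ (k + 1))| := by
        have := abs_sub_abs_le_abs_sub (f (q ^ (k + 1))) (f (q ^ k))
        rw [abs_sub_comm] at this
        linarith
      have hqk : 0 ≤ q ^ (k + 1) := pow_nonneg hq0.le _
      calc |f (q ^ (k + 1))| * q ^ (k + 1)
          ≤ (|f (q ^ k)| + |f (q ^ k) - f (q ^ (k + 1))|) * q ^ (k + 1) :=
            mul_le_mul_of_nonneg_right htri hqk
        _ = q * (|f (q ^ k)| * q ^ k) +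
            q / (1 - q) * (|f (q ^ k) - f (q ^ (k + 1))| * (q ^ k * (1 - q))) := by
            field_simp
            ring
    calc A (N + 1) = |f (q ^ 0)| * q ^ 0 + ∑ k ∈ range N, |f (q ^ (k + 1))| * q ^ (k + 1) := by
          simp only [hA_def]
          rw [Finset.sum_range_succ']
          ring
      _ ≤ |f 1| + ∑ k ∈ range N, (q * (|f (q ^ k)| * q ^ k) +
            q / (1 - q) * (|f (q ^ k) - f (q ^ (k + 1))| * (q ^ k * (1 - q)))) := by
          norm_num
          exact Finset.sum_le_sum fun k _ => hstep k
      _ = |f 1| + q * A N +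
            q / (1 - q) * ∑ k ∈ range N, |f (q ^ k) - f (q ^ (k + 1))| * (q ^ k * (1 - q)) := by
          rw [Finset.sum_add_distrib, ← Finset.mul_sum, ← Finset.mul_sum]
          ring
      _ ≤ |f 1| + q * A N + q / (1 - q) * (2 * ε) := by
          have := hA N
          gcongr
      _ = |f 1| + q * A N + 2 * ε * q / (1 - q) := by ring
  have hkey : (1 - q) * A (N + 1) ≤ |f 1| + 2 * ε * q / (1 - q) := by
    have := mul_le_mul_of_nonneg_left hmono hq0.le
    nlinarith
  calc ∑ k ∈ range N, |f (q ^ k)| * (q ^ k * (1 - q)) = (1 - q) * A N := by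
        simp only [hA_def, Finset.mul_sum]
        exact Finset.sum_congr rfl fun k _ => by ring
    _ ≤ (1 - q) * A (N + 1) := mul_le_mul_of_nonneg_left hmono h1q.le
    _ ≤ |f 1| + 2 * ε * q / (1 - q) := hkey

/-- **Necessity half of Osgood–Shisha's characterisation** [Osgood–Shisha 1976, Thm 3; quoted in
Davis–Rabinowitz Sect. 1.6.8]: a dominantly integrable `f` is dominated on `(0, 1]` by a monotone nonincreasing,
improperly integrable `h` — namely by its least antitone majorant `h(t) = sup_{[t,1]} |f|`. Proof: on a geometric
grid of ratio `q` the definition (with `ε = 1`) bounds the weighted `ℓ¹` distance between any two tag families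
(`sum_abs_sub_mul_lt`); comparing left and right endpoints gives the contraction `sum_abs_endpoint_mul_le`, whence
`Σ_k sup_{[q^{k+1}, q^k]} |f| · q^k (1-q) < ∞` (near-maximal tags), which makes the antitone envelope integrable.
[cite: DavisRabinowitz1984, Sect. 1.6.8] -/
theorem OsgoodShishaNecessity_holds : ∀ f : ℝ → ℝ, OsgoodShishaNecessity f := by
  intro f hf
  obtain ⟨I, hI⟩ := hf
  obtain ⟨δ, χ, hδ, -, hχ, -, hP⟩ := hI 1 one_pos
  -- the ratio `q` of the grid
  set q : ℝ := max (1 - δ / 2) (1 / 2) with hq_def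
  have hq0 : 0 < q := lt_of_lt_of_le (by norm_num) (le_max_right _ _)
  have hq1 : q < 1 := max_lt (by linarith) (by norm_num)
  have hδq : 1 - δ < q := lt_of_lt_of_le (by linarith) (le_max_left _ _)
  have h1q : 0 < 1 - q := by linarith
  have hq1' : q ≤ 1 := hq1.le
  set w : ℕ → ℝ := fun k => q ^ k * (1 - q) with hw_def
  have hw_pos : ∀ k, 0 < w k := fun k => mul_pos (pow_pos hq0 k) h1q
  have hw_sum : ∀ N, ∑ k ∈ range N, w k = 1 - q ^ N := by
    intro N
    induction N with
    | zero => simp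
    | succ N ih => rw [Finset.sum_range_succ, ih, hw_def, pow_succ]; ring
  have hw_sum_le : ∀ N, ∑ k ∈ range N, w k ≤ 1 := fun N => by
    rw [hw_sum]; linarith [pow_nonneg hq0.le N]
  -- (A) two tag families are `ℓ¹`-close (ε = 1)
  have hA : ∀ (N : ℕ) (x y : ℕ → ℝ), (∀ k < N, q ^ (k + 1) ≤ x k ∧ x k ≤ q ^ k) →
      (∀ k < N, q ^ (k + 1) ≤ y k ∧ y k ≤ q ^ k) →
      ∑ k ∈ range N, |f (x k) - f (y k)| * w k < 2 * 1 := fun N x y hx hy =>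
    sum_abs_sub_mul_lt hq0 hq1 hδq hχ hP N hx hy
  have hend : ∀ k : ℕ, q ^ (k + 1) ≤ q ^ k ∧ q ^ k ≤ q ^ k := fun k =>
    ⟨pow_le_pow_of_le_one hq0.le hq1' (Nat.le_succ k), le_rfl⟩
  -- (B) endpoint values are weighted-summable
  set C₁ : ℝ := |f 1| + 2 * 1 * q / (1 - q) with hC₁
  have hB : ∀ N, ∑ k ∈ range N, |f (q ^ k)| * w k ≤ C₁ := fun N =>
    sum_abs_endpoint_mul_le hq0 hq1 (fun N => hA N _ _ (fun k _ => hend k)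
      (fun k _ => ⟨le_rfl, (hend k).1⟩)) N
  -- (C) `f` is bounded on each cell
  set cell : ℕ → Set ℝ := fun k => Icc (q ^ (k + 1)) (q ^ k) with hcell
  have hC : ∀ k, ∀ z ∈ cell k, |f z| ≤ |f (q ^ k)| + 2 / w k := by
    intro k z hz
    classical
    set x : ℕ → ℝ := fun j => if j = k then z else q ^ j with hx
    have hxv : ∀ j < k + 1, q ^ (j + 1) ≤ x j ∧ x j ≤ q ^ j := fun j _ => by
      simp only [hx]
      split_ifs with h
      · subst h; exact hz
      · exact hend j
    have h2 := hA (k + 1) x (fun j => q ^ j) hxv (fun j _ => hend j)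
    have hterm : |f z - f (q ^ k)| * w k ≤ ∑ j ∈ range (k + 1), |f (x j) - f (q ^ j)| * w j := by
      have := Finset.single_le_sum (f := fun j => |f (x j) - f (q ^ j)| * w j)
        (fun j _ => mul_nonneg (abs_nonneg _) (hw_pos j).le) (self_mem_range_succ k)
      simpa [hx] using this
    have hlt : |f z - f (q ^ k)| * w k < 2 := by linarith
    have hdiv : |f z - f (q ^ k)| < 2 / w k := by
      rw [lt_div_iff₀ (hw_pos k)]; exact hlt
    have := abs_sub_abs_le_abs_sub (f z) (f (q ^ k))
    linarith
  -- per-cell suprema `m k`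
  have hcell_ne : ∀ k, (cell k).Nonempty := fun k => ⟨q ^ k, (hend k).1, le_rfl⟩
  have hbdd : ∀ k, BddAbove ((fun z => |f z|) '' cell k) := fun k =>
    ⟨|f (q ^ k)| + 2 / w k, by rintro _ ⟨z, hz, rfl⟩; exact hC k z hz⟩
  set m : ℕ → ℝ := fun k => sSup ((fun z => |f z|) '' cell k) with hm_def
  have hm_le : ∀ k, ∀ z ∈ cell k, |f z| ≤ m k := fun k z hz =>
    le_csSup (hbdd k) (mem_image_of_mem _ hz)
  have hm_nonneg : ∀ k, 0 ≤ m k := fun k =>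
    (abs_nonneg _).trans (hm_le k (q ^ k) ⟨(hend k).1, le_rfl⟩)
  have hm_lt : ∀ k, ∀ η > 0, ∃ z ∈ cell k, m k - η < |f z| := by
    intro k η hη
    obtain ⟨_, ⟨z, hz, rfl⟩, h⟩ :=
      exists_lt_of_lt_csSup ((hcell_ne k).image _) (sub_lt_self (m k) hη)
    exact ⟨z, hz, h⟩
  -- (D) the cell suprema are weighted-summable
  set C₂ : ℝ := C₁ + 2 with hC₂
  have hD : ∀ N, ∑ k ∈ range N, m k * w k ≤ C₂ := by
    intro N
    refine le_of_forall_pos_lt_add fun η hη => ?_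
    choose z hz hmz using fun k => hm_lt k η hη
    have h2 := hA N z (fun k => q ^ k) (fun k _ => hz k) (fun k _ => hend k)
    have h3 : ∑ k ∈ range N, |f (z k)| * w k ≤
        ∑ k ∈ range N, |f (q ^ k)| * w k + ∑ k ∈ range N, |f (z k) - f (q ^ k)| * w k := by
      rw [← Finset.sum_add_distrib]
      refine Finset.sum_le_sum fun k _ => ?_
      rw [← add_mul]
      refine mul_le_mul_of_nonneg_right ?_ (hw_pos k).le
      have := abs_sub_abs_le_abs_sub (f (z k)) (f (q ^ k))
      linarith
    have h4 : ∑ k ∈ range N, m k * w k ≤ ∑ k ∈ range N, |f (z k)| * w k + η := by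
      calc ∑ k ∈ range N, m k * w k
          = ∑ k ∈ range N, (m k - η) * w k + η * ∑ k ∈ range N, w k := by
            rw [Finset.mul_sum, ← Finset.sum_add_distrib]
            exact Finset.sum_congr rfl fun k _ => by ring
        _ ≤ ∑ k ∈ range N, |f (z k)| * w k + η * 1 := by
            refine add_le_add (Finset.sum_le_sum fun k _ => ?_)
              (mul_le_mul_of_nonneg_left (hw_sum_le N) hη.le)
            exact mul_le_mul_of_nonneg_right (hmz k).le (hw_pos k).le
        _ = _ := by ring
    linarith [hB N]
  -- (E) the antitone envelope `h`
  have hpow_le : ∀ {a b : ℕ}, q ^ a ≤ q ^ b → b ≤ a := fun h =>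
    (pow_le_pow_iff_right_of_lt_one₀ hq0 hq1).mp h
  set M : ℕ → ℝ := fun K => ∑ j ∈ range (K + 2), m j with hM_def
  have hfin : ∀ (K : ℕ) (y : ℝ), q ^ (K + 1) ≤ y → y ≤ 1 → |f y| ≤ M K := by
    intro K y hy1 hy2
    have hy0 : 0 < y := lt_of_lt_of_le (pow_pos hq0 _) hy1
    obtain ⟨n, hn1, hn2⟩ := exists_nat_pow_near_of_lt_one hy0 hy2 hq0 hq1
    have hnK : n ≤ K + 1 := hpow_le (hy1.trans hn2)
    calc |f y| ≤ m n := hm_le n y ⟨hn1.le, hn2⟩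
      _ ≤ M K := by
        simp only [hM_def]
        exact Finset.single_le_sum (f := m) (fun j _ => hm_nonneg j)
          (mem_range.mpr (by omega))
  set h : ℝ → ℝ := fun t => sSup ((fun z => |f z|) '' Icc t 1) with hh_def
  have hne1 : ∀ t, t ≤ 1 → ((fun z => |f z|) '' Icc t 1).Nonempty := fun t ht =>
    ⟨|f t|, t, ⟨le_rfl, ht⟩, rfl⟩
  have hbdd1 : ∀ t ∈ Ioc (0 : ℝ) 1, BddAbove ((fun z => |f z|) '' Icc t 1) := by
    intro t ht
    obtain ⟨K, hK1, hK2⟩ := exists_nat_pow_near_of_lt_one ht.1 ht.2 hq0 hq1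
    exact ⟨M K, by rintro _ ⟨y, hy, rfl⟩; exact hfin K y (hK1.le.trans hy.1) hy.2⟩
  have hh_ge : ∀ t ∈ Ioc (0 : ℝ) 1, |f t| ≤ h t := fun t ht =>
    le_csSup (hbdd1 t ht) ⟨t, ⟨le_rfl, ht.2⟩, rfl⟩
  have hh_nonneg : ∀ t ∈ Ioc (0 : ℝ) 1, 0 ≤ h t := fun t ht => (abs_nonneg _).trans (hh_ge t ht)
  have hh_anti : AntitoneOn h (Ioc 0 1) := by
    intro s hs t ht hst
    exact csSup_le_csSup (hbdd1 s hs) (hne1 t ht.2) (image_mono (Icc_subset_Icc hst le_rfl))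
  have hh_le : ∀ (K : ℕ) (t : ℝ), q ^ (K + 1) ≤ t → t ≤ 1 → h t ≤ M K := fun K t ht1 ht2 =>
    csSup_le (hne1 t ht2) (by rintro _ ⟨y, hy, rfl⟩; exact hfin K y (ht1.trans hy.1) hy.2)
  -- (F) integrability of `h` on `(0, 1]`
  have hS_eq : ∀ N, ∑ k ∈ range N, M k * w k =
      ∑ j ∈ range (N + 1), m j * (q ^ (j - 1) - q ^ N) := by
    intro N
    induction N with
    | zero => simp
    | succ N ih =>
      rw [Finset.sum_range_succ, ih, Finset.sum_range_succ _ (N + 1), Nat.add_sub_cancel]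
      have hMN : M N = ∑ j ∈ range (N + 1), m j + m (N + 1) := by
        simp only [hM_def]
        rw [Finset.sum_range_succ]
      rw [hMN]
      have : ∑ j ∈ range (N + 1), m j * (q ^ (j - 1) - q ^ (N + 1)) =
          ∑ j ∈ range (N + 1), m j * (q ^ (j - 1) - q ^ N) +
            (∑ j ∈ range (N + 1), m j) * (q ^ N * (1 - q)) := by
        rw [Finset.sum_mul, ← Finset.sum_add_distrib]
        exact Finset.sum_congr rfl fun j _ => by ring
      rw [this, hw_def]
      ring
  set B : ℝ := C₂ / (q * (1 - q)) with hB_def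
  have hS_le : ∀ N, ∑ k ∈ range N, M k * w k ≤ B := by
    intro N
    rw [hS_eq]
    have hqq : ∀ j : ℕ, q ^ (j - 1) ≤ q ^ j / q := by
      intro j
      rw [le_div_iff₀ hq0]
      cases j with
      | zero => simpa using hq1'
      | succ j => rw [Nat.add_sub_cancel, pow_succ]
    calc ∑ j ∈ range (N + 1), m j * (q ^ (j - 1) - q ^ N)
        ≤ ∑ j ∈ range (N + 1), m j * w j / (q * (1 - q)) := by
          refine Finset.sum_le_sum fun j _ => ?_
          have hmj := hm_nonneg j
          have hqN : 0 ≤ q ^ N := pow_nonneg hq0.le N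
          calc m j * (q ^ (j - 1) - q ^ N) ≤ m j * q ^ (j - 1) :=
                mul_le_mul_of_nonneg_left (by linarith) hmj
            _ ≤ m j * (q ^ j / q) := mul_le_mul_of_nonneg_left (hqq j) hmj
            _ = m j * w j / (q * (1 - q)) := by
                rw [hw_def]
                field_simp
      _ = (∑ j ∈ range (N + 1), m j * w j) / (q * (1 - q)) := by rw [Finset.sum_div]
      _ ≤ C₂ / (q * (1 - q)) := by gcongr; exact hD (N + 1)
  have hanti_cell : ∀ a, 0 < a → a ≤ 1 → AntitoneOn h (uIcc a 1) := fun a ha ha1 => by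
    rw [Set.uIcc_of_le ha1]
    exact hh_anti.mono fun t ht => ⟨ha.trans_le ht.1, ht.2⟩
  have hii : ∀ a, 0 < a → a ≤ 1 → IntervalIntegrable h volume a 1 := fun a ha ha1 =>
    (hanti_cell a ha ha1).intervalIntegrable
  have hint_cell : ∀ N : ℕ, IntegrableOn h (Ioc (q ^ N) 1) := fun N =>
    (hii (q ^ N) (pow_pos hq0 N) (pow_le_one₀ hq0.le hq1')).1
  have hint_bound : ∀ N : ℕ, ∫ x in Ioc (q ^ N) 1, ‖h x‖ ≤ B := by
    intro N
    have hqN1 : q ^ N ≤ 1 := pow_le_one₀ hq0.le hq1'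
    have e1 : ∫ x in Ioc (q ^ N) 1, ‖h x‖ = ∫ x in Ioc (q ^ N) 1, h x :=
      setIntegral_congr_fun measurableSet_Ioc fun x hx =>
        Real.norm_of_nonneg (hh_nonneg x ⟨(pow_pos hq0 N).trans hx.1, hx.2⟩)
    rw [e1, ← intervalIntegral.integral_of_le hqN1]
    -- split along the grid `a j = q^(N-j)`
    have hadj := intervalIntegral.sum_integral_adjacent_intervals (μ := volume) (f := h)
      (a := fun j => q ^ (N - j)) (n := N) (fun j hj => by
        have e : N - j = (N - (j + 1)) + 1 := by omega
        have hle : q ^ (N - j) ≤ q ^ (N - (j + 1)) := by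
          rw [e]; exact (hend _).1
        have := hii (q ^ (N - j)) (pow_pos hq0 _) (pow_le_one₀ hq0.le hq1')
        exact (this.trans (hii (q ^ (N - (j + 1))) (pow_pos hq0 _)
          (pow_le_one₀ hq0.le hq1')).symm))
    simp only [Nat.sub_zero, Nat.sub_self, pow_zero] at hadj
    rw [← hadj]
    calc ∑ j ∈ range N, ∫ x in q ^ (N - j)..q ^ (N - (j + 1)), h x
        ≤ ∑ j ∈ range N, M (N - 1 - j) * w (N - 1 - j) := by
          refine Finset.sum_le_sum fun j hj => ?_
          have hj' : j < N := mem_range.mp hj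
          have e1 : N - (j + 1) = N - 1 - j := by omega
          have e2 : N - j = (N - 1 - j) + 1 := by omega
          rw [e1, e2]
          set k := N - 1 - j
          have hle : q ^ (k + 1) ≤ q ^ k := (hend k).1
          calc ∫ x in q ^ (k + 1)..q ^ k, h x ≤ ∫ x in q ^ (k + 1)..q ^ k, M k := by
                refine intervalIntegral.integral_mono_on hle ?_ ?_ fun x hx => ?_
                · exact ((hanti_cell _ (pow_pos hq0 _) (pow_le_one₀ hq0.le hq1')).mono
                    (by rw [Set.uIcc_of_le hle, Set.uIcc_of_le (pow_le_one₀ hq0.le hq1')]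
                        exact Icc_subset_Icc le_rfl (pow_le_one₀ hq0.le hq1'))).intervalIntegrable
                · exact intervalIntegrable_const
                · exact hh_le k x hx.1 (hx.2.trans (pow_le_one₀ hq0.le hq1'))
            _ = M k * w k := by
                rw [intervalIntegral.integral_const, smul_eq_mul, hw_def, pow_succ]
                ring
      _ = ∑ k ∈ range N, M k * w k := Finset.sum_range_reflect (fun k => M k * w k) N
      _ ≤ B := hS_le N
  have hInt : IntegrableOn h (Ioc 0 1) :=
    integrableOn_Ioc_of_intervalIntegral_norm_bounded_left (l := atTop) hint_cell
      (tendsto_pow_atTop_nhds_zero_of_lt_one hq0.le hq1) (Eventually.of_forall hint_bound)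
  -- (G) the improper integral of `h` converges
  refine ⟨h, hh_anti, hh_ge, ∫ x in (0 : ℝ)..1, h x, ?_⟩
  have hIcc : IntegrableOn h (uIcc 0 1) := by
    rw [Set.uIcc_of_le zero_le_one]
    exact (integrableOn_Icc_iff_integrableOn_Ioc (f := h) (a := 0) (b := 1)).mpr hInt
  have hcont := intervalIntegral.continuousOn_primitive_interval_left hIcc
  have h0 : (0 : ℝ) ∈ uIcc (0 : ℝ) 1 := left_mem_uIcc
  have hT := (hcont 0 h0).tendsto
  simp only [Set.uIcc_of_le (zero_le_one : (0 : ℝ) ≤ 1)] at hT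
  refine hT.mono_left ?_
  rw [← nhdsWithin_Ioo_eq_nhdsGT zero_lt_one]
  exact nhdsWithin_mono _ Ioo_subset_Icc_self

end Necessity

/-! ## Sufficiency: continuous functions with an integrable antitone majorant -/

section Sufficiency

/-- Disjoint scaled cells: for `c > 0` the intervals `(c t_j, c t_{j+1}]`, `j ∈ S`, of a partition are pairwise
disjoint, so the integrals of a nonnegative `g` over those of them that lie in `(0, a]` add up to at most
`∫_{(0,a]} g`. [cite: DavisRabinowitz1984, Sect. 1.6.8] -/
theorem OSPartition.sum_setIntegral_Ioc_le (P : OSPartition) {g : ℝ → ℝ} {a c : ℝ} (hc : 0 < c)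
    (hg : IntegrableOn g (Ioc 0 a)) (hg0 : ∀ x ∈ Ioc 0 a, 0 ≤ g x) (S : Finset ℕ)
    (hS : ∀ j ∈ S, j < P.n ∧ c * P.t (j + 1) ≤ a) :
    ∑ j ∈ S, ∫ x in Ioc (c * P.t j) (c * P.t (j + 1)), g x ≤ ∫ x in Ioc 0 a, g x := by
  have hsub1 : ∀ j ∈ S, Ioc (c * P.t j) (c * P.t (j + 1)) ⊆ Ioc 0 a := fun j hj =>
    Ioc_subset_Ioc (mul_nonneg hc.le (P.t_pos (hS j hj).1.le).le) (hS j hj).2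
  have hdisj : (↑S : Set ℕ).Pairwise
      (Function.onFun Disjoint fun j => Ioc (c * P.t j) (c * P.t (j + 1))) := by
    intro i hi j hj hne
    have key : ∀ i ∈ S, ∀ j ∈ S, i < j →
        Disjoint (Ioc (c * P.t i) (c * P.t (i + 1))) (Ioc (c * P.t j) (c * P.t (j + 1))) := by
      intro i hi j hj hij
      refine Set.disjoint_left.mpr fun x hx hx' => ?_
      have hmono : P.t (i + 1) ≤ P.t j := P.t_mono (Nat.succ_le_of_lt hij) (hS j hj).1.le
      have := mul_le_mul_of_nonneg_left hmono hc.le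
      linarith [hx.2, hx'.1]
    rcases lt_or_gt_of_ne hne with h | h
    · exact key i hi j hj h
    · exact (key j hj i hi h).symm
  have hsub : (⋃ j ∈ S, Ioc (c * P.t j) (c * P.t (j + 1))) ⊆ Ioc 0 a :=
    iUnion₂_subset hsub1
  rw [← integral_biUnion_finset S (fun j _ => measurableSet_Ioc) hdisj
    (fun j hj => hg.mono_set (hsub1 j hj))]
  exact setIntegral_mono_set hg (ae_restrict_of_forall_mem measurableSet_Ioc hg0) hsub.eventuallyLE

/-- **Sufficiency half of Osgood–Shisha's characterisation (continuous case)** [Osgood–Shisha 1976; quoted in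
Davis–Rabinowitz Sect. 1.6.8]: a function continuous on `(0, 1]` and dominated there by a monotone nonincreasing,
improperly integrable `h` is dominantly integrable, with dominated integral the (Lebesgue) integral `∫_{(0,1]} f`.
Proof: `|∫_{(0,t_0]} f| ≤ ∫_0^χ h`; on cells above a fixed level uniform continuity controls `∫_{C_j} f - f(τ_j)|C_j|`;
on the cells below it the error is at most `∫_{C_j} h + h(t_{j-1})|C_j|`, and `Σ h(t_{j-1})|C_j| ≤ (1-δ)⁻¹ ∫_0^χ h`
because the rescaled cells `(1-δ) C_j` are disjoint and `h ≥ h(t_{j-1})` on them (the ratio condition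
`t_{j-1} > (1-δ) t_j` is exactly what makes `(1-δ) C_j` lie to the left of `t_{j-1}`).
[cite: DavisRabinowitz1984, Sect. 1.6.8] -/
theorem OsgoodShishaSufficiency_holds : ∀ f : ℝ → ℝ, OsgoodShishaSufficiency f := by
  intro f hfc hdom
  obtain ⟨h, hha, hfh, J, hJ⟩ := hdom
  have hh0 : ∀ t ∈ Ioc (0 : ℝ) 1, 0 ≤ h t := fun t ht => (abs_nonneg _).trans (hfh t ht)
  -- interval integrability of the antitone `h` on subintervals of `(0, 1]`
  have hii2 : ∀ a b : ℝ, 0 < a → a ≤ b → b ≤ 1 → IntervalIntegrable h volume a b := by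
    intro a b ha hab hb
    refine (hha.mono ?_).intervalIntegrable
    rw [Set.uIcc_of_le hab]
    exact fun t ht => ⟨ha.trans_le ht.1, ht.2.trans hb⟩
  have hii : ∀ a : ℝ, 0 < a → a ≤ 1 → IntervalIntegrable h volume a 1 := fun a ha ha1 =>
    hii2 a 1 ha ha1 le_rfl
  -- `∫_r^1 h ≤ J`
  have hF_le : ∀ r ∈ Ioo (0 : ℝ) 1, ∫ x in r..1, h x ≤ J := by
    intro r hr
    refine ge_of_tendsto hJ ?_
    filter_upwards [Ioo_mem_nhdsGT hr.1] with s hs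
    rw [← intervalIntegral.integral_add_adjacent_intervals (hii2 s r hs.1 hs.2.le hr.2.le)
      (hii r hr.1 hr.2.le)]
    have : 0 ≤ ∫ x in s..r, h x :=
      intervalIntegral.integral_nonneg hs.2.le fun x hx => hh0 x ⟨hs.1.trans_le hx.1, hx.2.trans hr.2.le⟩
    linarith
  -- integrability of `h` on `(0, 1]`
  have hInt : IntegrableOn h (Ioc 0 1) := by
    have hhalf : ∀ N : ℕ, (0 : ℝ) < (1 / 2) ^ (N + 1) ∧ ((1 : ℝ) / 2) ^ (N + 1) < 1 := fun N =>
      ⟨by positivity, pow_lt_one₀ (by norm_num) (by norm_num) (Nat.succ_ne_zero N)⟩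
    refine integrableOn_Ioc_of_intervalIntegral_norm_bounded_left (l := atTop)
      (a := fun N : ℕ => ((1 : ℝ) / 2) ^ (N + 1)) (I := J) (fun N => (hii _ (hhalf N).1 (hhalf N).2.le).1)
      ?_ (Eventually.of_forall fun N => ?_)
    · have := tendsto_pow_atTop_nhds_zero_of_lt_one (r := (1 : ℝ) / 2) (by norm_num) (by norm_num)
      exact this.comp (tendsto_add_atTop_nat 1)
    · have e1 : ∫ x in Ioc (((1 : ℝ) / 2) ^ (N + 1)) 1, ‖h x‖ = ∫ x in Ioc (((1 : ℝ) / 2) ^ (N + 1)) 1, h x :=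
        setIntegral_congr_fun measurableSet_Ioc fun x hx =>
          Real.norm_of_nonneg (hh0 x ⟨(hhalf N).1.trans hx.1, hx.2⟩)
      rw [e1, ← intervalIntegral.integral_of_le (hhalf N).2.le]
      exact hF_le _ ⟨(hhalf N).1, (hhalf N).2⟩
  -- integrability of `f` on `(0, 1]` and the value of the dominated integral
  have hfm : AEStronglyMeasurable f (volume.restrict (Ioc 0 1)) :=
    hfc.aestronglyMeasurable measurableSet_Ioc
  have hfInt : IntegrableOn f (Ioc 0 1) :=
    Integrable.mono' hInt hfm (ae_restrict_of_forall_mem measurableSet_Ioc fun x hx => by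
      rw [Real.norm_eq_abs]; exact hfh x hx)
  set I : ℝ := ∫ x in Ioc (0 : ℝ) 1, f x with hI_def
  refine ⟨I, fun ε hε => ?_⟩
  set ε' : ℝ := ε / 6 with hε'
  have hε'0 : 0 < ε' := by positivity
  -- (1) the level `a` with `∫_{(0,a]} h < ε'`
  have hIcc : IntegrableOn h (Set.uIcc 0 1) := by
    rw [Set.uIcc_of_le zero_le_one]
    exact (integrableOn_Icc_iff_integrableOn_Ioc (f := h) (a := 0) (b := 1)).mpr hInt
  obtain ⟨a, ha, haε⟩ : ∃ a ∈ Ioo (0 : ℝ) 1, ∫ x in Ioc 0 a, h x < ε' := by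
    have hcont := intervalIntegral.continuousOn_primitive_interval hIcc
    have h0 : (0 : ℝ) ∈ Set.uIcc (0 : ℝ) 1 := left_mem_uIcc
    have hT := (hcont 0 h0).tendsto
    simp only [Set.uIcc_of_le (zero_le_one : (0 : ℝ) ≤ 1), intervalIntegral.integral_same] at hT
    have hT' : Tendsto (fun x => ∫ t in (0 : ℝ)..x, h t) (𝓝[Ioo 0 1] 0) (𝓝 0) :=
      hT.mono_left (nhdsWithin_mono _ Ioo_subset_Icc_self)
    have hev : ∀ᶠ x in 𝓝[Ioo (0 : ℝ) 1] 0, ∫ t in (0 : ℝ)..x, h t < ε' :=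
      hT' (Iio_mem_nhds hε'0)
    haveI : (𝓝[Ioo (0 : ℝ) 1] 0).NeBot := by
      rw [nhdsWithin_Ioo_eq_nhdsGT zero_lt_one]; infer_instance
    obtain ⟨a, ha1, ha2⟩ := (hev.and self_mem_nhdsWithin).exists
    refine ⟨a, ha2, ?_⟩
    rwa [intervalIntegral.integral_of_le ha2.1.le] at ha1
  have hInt_a : IntegrableOn h (Ioc 0 a) := hInt.mono_set (Ioc_subset_Ioc le_rfl ha.2.le)
  have hh0a : ∀ x ∈ Ioc 0 a, 0 ≤ h x := fun x hx => hh0 x ⟨hx.1, hx.2.trans ha.2.le⟩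
  -- (2) uniform continuity of `f` on `[a/2, 1]`
  set K : Set ℝ := Icc (a / 2) 1 with hK_def
  have hKsub : K ⊆ Ioc 0 1 := fun x hx => ⟨by linarith [hx.1, ha.1], hx.2⟩
  have hUC : UniformContinuousOn f K := isCompact_Icc.uniformContinuousOn_of_continuous (hfc.mono hKsub)
  obtain ⟨δ₁, hδ₁, hUC'⟩ := Metric.uniformContinuousOn_iff.mp hUC ε' hε'0
  -- (3) the parameters
  set δ : ℝ := min (1 / 2) δ₁ with hδ_def
  have hδ0 : 0 < δ := lt_min (by norm_num) hδ₁
  have hδhalf : δ ≤ 1 / 2 := min_le_left _ _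
  have hδ1 : δ ≤ δ₁ := min_le_right _ _
  refine ⟨δ, a, hδ0, by linarith, ha.1, ha.2, fun P hP => ?_⟩
  -- (4) the estimate
  obtain ⟨hP0, hPr⟩ := hP
  have ht1 : ∀ j, j ≤ P.n → P.t j ≤ 1 := fun j hj => P.t_le_one hj
  have hratio : ∀ j < P.n, (1 - δ) * P.t (j + 1) < P.t j := by
    intro j hj
    have := hPr j hj
    rwa [lt_div_iff₀ (P.t_pos (Nat.succ_le_of_lt hj))] at this
  have hlen : ∀ j < P.n, P.t (j + 1) - P.t j < δ * P.t (j + 1) := fun j hj => by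
    have := hratio j hj; linarith
  have hlen' : ∀ j < P.n, P.t (j + 1) - P.t j < δ₁ := fun j hj => by
    have := hlen j hj
    have := ht1 (j + 1) (Nat.succ_le_of_lt hj)
    nlinarith
  -- integrability of `f` on the cells and the decomposition of `I`
  have hfii : ∀ u v : ℝ, 0 ≤ u → u ≤ v → v ≤ 1 → IntervalIntegrable f volume u v := by
    intro u v hu huv hv
    rw [intervalIntegrable_iff_integrableOn_Ioc_of_le huv]
    exact hfInt.mono_set (Ioc_subset_Ioc hu hv)
  have hsplit : I = (∫ x in Ioc 0 (P.t 0), f x) + ∑ j ∈ range P.n, ∫ x in P.t j..P.t (j + 1), f x := by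
    have h1 : I = ∫ x in (0 : ℝ)..1, f x := (intervalIntegral.integral_of_le zero_le_one).symm
    have h2 := intervalIntegral.integral_add_adjacent_intervals
      (hfii 0 (P.t 0) le_rfl P.t_zero_pos.le (ht1 0 (Nat.zero_le _)))
      (hfii (P.t 0) 1 P.t_zero_pos.le (ht1 0 (Nat.zero_le _)) le_rfl)
    have h3 := intervalIntegral.sum_integral_adjacent_intervals (μ := volume) (f := f) (a := P.t)
      (n := P.n) fun k hk => hfii _ _ (P.t_pos (Nat.le_of_lt hk)).le (P.t_lt_succ k hk).le
        (ht1 _ (Nat.succ_le_of_lt hk))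
    rw [P.t_last] at h3
    rw [h1, ← h2, h3, intervalIntegral.integral_of_le P.t_zero_pos.le]
  have hrsum : P.rsum f = ∑ j ∈ range P.n, ∫ x in P.t j..P.t (j + 1), f (P.τ (j + 1)) := by
    unfold OSPartition.rsum
    refine Finset.sum_congr rfl fun j _ => ?_
    rw [intervalIntegral.integral_const, smul_eq_mul, mul_comm]
  -- the cell errors
  set e : ℕ → ℝ := fun j => |∫ x in P.t j..P.t (j + 1), (f x - f (P.τ (j + 1)))| with he_def
  set b : ℕ → ℝ := fun j =>
    if P.t j < a / 2 then (∫ x in Ioc (P.t j) (P.t (j + 1)), h x) + h (P.t j) * (P.t (j + 1) - P.t j)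
    else ε' * (P.t (j + 1) - P.t j) with hb_def
  have heb : ∀ j < P.n, e j ≤ b j := by
    intro j hj
    have htj : 0 < P.t j := P.t_pos hj.le
    have htj1 : P.t (j + 1) ≤ 1 := ht1 _ (Nat.succ_le_of_lt hj)
    have hlt : P.t j < P.t (j + 1) := P.t_lt_succ j hj
    obtain ⟨hτ1, hτ2⟩ := P.tag_mem j hj
    simp only [he_def, hb_def]
    split_ifs with hlow
    · -- low cell
      have hτI : P.τ (j + 1) ∈ Ioc (0 : ℝ) 1 := ⟨htj.trans_le hτ1, hτ2.trans htj1⟩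
      have htjI : P.t j ∈ Ioc (0 : ℝ) 1 := ⟨htj, hlt.le.trans htj1⟩
      have hbound : ∀ᵐ x : ℝ, x ∈ Ioc (P.t j) (P.t (j + 1)) →
          ‖f x - f (P.τ (j + 1))‖ ≤ h x + h (P.t j) := by
        refine Eventually.of_forall fun x hx => ?_
        have hxI : x ∈ Ioc (0 : ℝ) 1 := ⟨htj.trans hx.1, hx.2.trans htj1⟩
        rw [Real.norm_eq_abs]
        calc |f x - f (P.τ (j + 1))| ≤ |f x| + |f (P.τ (j + 1))| := abs_sub _ _
          _ ≤ h x + h (P.τ (j + 1)) := add_le_add (hfh x hxI) (hfh _ hτI)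
          _ ≤ h x + h (P.t j) := add_le_add le_rfl (hha htjI hτI hτ1)
      have hgi : IntervalIntegrable (fun x => h x + h (P.t j)) volume (P.t j) (P.t (j + 1)) :=
        (hii2 _ _ htj hlt.le htj1).add intervalIntegrable_const
      have := intervalIntegral.norm_integral_le_of_norm_le hlt.le hbound hgi
      rw [Real.norm_eq_abs] at this
      refine this.trans (le_of_eq ?_)
      rw [intervalIntegral.integral_add (hii2 _ _ htj hlt.le htj1) intervalIntegrable_const,
        intervalIntegral.integral_const, smul_eq_mul, intervalIntegral.integral_of_le hlt.le]
      ring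
    · -- high cell
      have hhigh : a / 2 ≤ P.t j := not_lt.mp hlow
      have hC : ∀ x ∈ Set.uIoc (P.t j) (P.t (j + 1)), ‖f x - f (P.τ (j + 1))‖ ≤ ε' := by
        intro x hx
        rw [Set.uIoc_of_le hlt.le] at hx
        have hxK : x ∈ K := ⟨hhigh.trans hx.1.le, hx.2.trans htj1⟩
        have hτK : P.τ (j + 1) ∈ K := ⟨hhigh.trans hτ1, hτ2.trans htj1⟩
        have hdist : dist x (P.τ (j + 1)) < δ₁ := by
          rw [Real.dist_eq, abs_lt]
          constructor <;> linarith [hlen' j hj, hx.1, hx.2]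
        exact (le_of_lt (hUC' x hxK _ hτK hdist))
      have := intervalIntegral.norm_integral_le_of_norm_le_const hC
      rw [Real.norm_eq_abs, abs_of_pos (sub_pos.mpr hlt)] at this
      exact this
  -- summing the cell errors
  set LOW : Finset ℕ := (range P.n).filter fun j => P.t j < a / 2 with hLOW
  have hLOW : ∀ j ∈ LOW, j < P.n ∧ P.t (j + 1) < a := by
    intro j hj
    rw [hLOW, Finset.mem_filter, Finset.mem_range] at hj
    refine ⟨hj.1, ?_⟩
    have := hratio j hj.1
    nlinarith [hj.2, P.t_pos (Nat.succ_le_of_lt hj.1)]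
  have hsum_b : ∑ j ∈ range P.n, b j =
      (∑ j ∈ LOW, ∫ x in Ioc (P.t j) (P.t (j + 1)), h x) +
        (∑ j ∈ LOW, h (P.t j) * (P.t (j + 1) - P.t j)) +
        ∑ j ∈ (range P.n).filter (fun j => ¬ P.t j < a / 2), ε' * (P.t (j + 1) - P.t j) := by
    rw [hb_def, Finset.sum_ite, Finset.sum_add_distrib]
  -- (i) low cells: integrals of `h`
  have hlow1 : ∑ j ∈ LOW, ∫ x in Ioc (P.t j) (P.t (j + 1)), h x ≤ ∫ x in Ioc 0 a, h x := by
    have := P.sum_setIntegral_Ioc_le one_pos hInt_a hh0a LOW fun j hj =>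
      ⟨(hLOW j hj).1, by rw [one_mul]; exact (hLOW j hj).2.le⟩
    simpa only [one_mul] using this
  -- (ii) low cells: the left-endpoint sum, by rescaling the cells by `1 - δ`
  have hc0 : 0 < 1 - δ := by linarith
  have hlow2 : ∑ j ∈ LOW, h (P.t j) * (P.t (j + 1) - P.t j) ≤ (∫ x in Ioc 0 a, h x) / (1 - δ) := by
    rw [le_div_iff₀ hc0, Finset.sum_mul]
    have key : ∀ j ∈ LOW, h (P.t j) * (P.t (j + 1) - P.t j) * (1 - δ) ≤
        ∫ x in Ioc ((1 - δ) * P.t j) ((1 - δ) * P.t (j + 1)), h x := by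
      intro j hj
      obtain ⟨hjn, hja⟩ := hLOW j hj
      have htj : 0 < P.t j := P.t_pos hjn.le
      have hlt : P.t j < P.t (j + 1) := P.t_lt_succ j hjn
      have htj1 : P.t (j + 1) ≤ 1 := ht1 _ (Nat.succ_le_of_lt hjn)
      have hmeas : volume.real (Ioc ((1 - δ) * P.t j) ((1 - δ) * P.t (j + 1))) =
          (P.t (j + 1) - P.t j) * (1 - δ) := by
        rw [Real.volume_real_Ioc_of_le (by nlinarith)]
        ring
      have hge : ∀ x ∈ Ioc ((1 - δ) * P.t j) ((1 - δ) * P.t (j + 1)), h (P.t j) ≤ h x := by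
        intro x hx
        have hx0 : 0 < x := lt_of_le_of_lt (by nlinarith) hx.1
        have hxt : x ≤ P.t j := hx.2.trans (hratio j hjn).le
        exact hha ⟨hx0, hxt.trans (hlt.le.trans htj1)⟩ ⟨htj, hlt.le.trans htj1⟩ hxt
      have hsubI : Ioc ((1 - δ) * P.t j) ((1 - δ) * P.t (j + 1)) ⊆ Ioc 0 a :=
        Ioc_subset_Ioc (by nlinarith) (by nlinarith)
      have := setIntegral_ge_of_const_le_real measurableSet_Ioc (by simp)
        hge (hInt_a.mono_set hsubI)
      rwa [hmeas, ← mul_assoc] at this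
    refine (Finset.sum_le_sum key).trans ?_
    exact P.sum_setIntegral_Ioc_le hc0 hInt_a hh0a LOW fun j hj =>
      ⟨(hLOW j hj).1, by nlinarith [(hLOW j hj).2, P.t_pos (Nat.succ_le_of_lt (hLOW j hj).1)]⟩
  -- (iii) high cells
  have hhigh : ∑ j ∈ (range P.n).filter (fun j => ¬ P.t j < a / 2), ε' * (P.t (j + 1) - P.t j) ≤ ε' := by
    calc ∑ j ∈ (range P.n).filter (fun j => ¬ P.t j < a / 2), ε' * (P.t (j + 1) - P.t j)
        ≤ ∑ j ∈ range P.n, ε' * (P.t (j + 1) - P.t j) :=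
          Finset.sum_le_sum_of_subset_of_nonneg (Finset.filter_subset _ _) fun j hj _ =>
            mul_nonneg hε'0.le (P.weight_pos (mem_range.mp hj)).le
      _ = ε' * (1 - P.t 0) := by rw [← Finset.mul_sum, P.sum_weights]
      _ ≤ ε' := by nlinarith [P.t_zero_pos]
  -- the head `∫_{(0, t_0]} f`
  have hhead : |∫ x in Ioc 0 (P.t 0), f x| ≤ ∫ x in Ioc 0 a, h x := by
    have hsub0 : Ioc 0 (P.t 0) ⊆ Ioc 0 a := Ioc_subset_Ioc le_rfl hP0.le
    have h1 : ‖∫ x in Ioc 0 (P.t 0), f x‖ ≤ ∫ x in Ioc 0 (P.t 0), h x :=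
      norm_integral_le_of_norm_le (hInt_a.mono_set hsub0)
        (ae_restrict_of_forall_mem measurableSet_Ioc fun x hx => by
          rw [Real.norm_eq_abs]; exact hfh x ⟨hx.1, hx.2.trans (ht1 0 (Nat.zero_le _))⟩)
    rw [Real.norm_eq_abs] at h1
    exact h1.trans (setIntegral_mono_set hInt_a (ae_restrict_of_forall_mem measurableSet_Ioc hh0a)
      hsub0.eventuallyLE)
  -- conclusion
  have hmain : |I - P.rsum f| ≤ |∫ x in Ioc 0 (P.t 0), f x| + ∑ j ∈ range P.n, e j := by
    have hdiff : I - P.rsum f = (∫ x in Ioc 0 (P.t 0), f x) +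
        ∑ j ∈ range P.n, ∫ x in P.t j..P.t (j + 1), (f x - f (P.τ (j + 1))) := by
      rw [hsplit, hrsum, add_sub_assoc, ← Finset.sum_sub_distrib]
      congr 1
      refine Finset.sum_congr rfl fun j hj => ?_
      have hj' : j < P.n := mem_range.mp hj
      rw [intervalIntegral.integral_sub (hfii _ _ (P.t_pos hj'.le).le (P.t_lt_succ j hj').le
        (ht1 _ (Nat.succ_le_of_lt hj'))) intervalIntegrable_const]
    rw [hdiff]
    refine (abs_add_le _ _).trans (add_le_add le_rfl (Finset.abs_sum_le_sum_abs _ _))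
  have hδinv : (∫ x in Ioc 0 a, h x) / (1 - δ) ≤ 2 * ∫ x in Ioc 0 a, h x := by
    rw [div_le_iff₀ hc0]
    have : 0 ≤ ∫ x in Ioc 0 a, h x := setIntegral_nonneg measurableSet_Ioc hh0a
    nlinarith
  calc |I - P.rsum f| ≤ |∫ x in Ioc 0 (P.t 0), f x| + ∑ j ∈ range P.n, e j := hmain
    _ ≤ (∫ x in Ioc 0 a, h x) + ∑ j ∈ range P.n, b j :=
        add_le_add hhead (Finset.sum_le_sum fun j hj => heb j (mem_range.mp hj))
    _ < ε' + (ε' + 2 * ε' + ε') := by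
        rw [hsum_b]
        have := add_le_add (add_le_add hlow1 hlow2) hhigh
        linarith
    _ ≤ ε := by rw [hε']; linarith

end Sufficiency

/-! # Appendix: proof of the Osgood–Shisha statement (i) -/

namespace OSPartition

/-! ## Re-tagging and uniform partitions -/

/-- The same partition with other tags. [cite: DavisRabinowitz1984, Sect. 1.6.8] -/
def retag (P : OSPartition) (σ : ℕ → ℝ)
    (hσ : ∀ j < P.n, P.t j ≤ σ (j + 1) ∧ σ (j + 1) ≤ P.t (j + 1)) : OSPartition :=
  { P with τ := σ, tag_mem := hσ }

/-- **Two tag families on one partition.** If every `(δ, χ)`-admissible sum is within `ε` of `I` and `P` is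
admissible, then the values of `f` at two tag families for `P` differ, in the weighted `ℓ¹` sense, by less than
`2ε` (swap the tags cell by cell so that all the differences have the same sign).
[cite: DavisRabinowitz1984, Sect. 1.6.8] -/
theorem sum_abs_sub_mul_weight_lt (P : OSPartition) {f : ℝ → ℝ} {I ε δ χ : ℝ}
    (hI : ∀ Q : OSPartition, Q.Admissible δ χ → |I - Q.rsum f| < ε) (hP : P.Admissible δ χ)
    {σ σ' : ℕ → ℝ} (hσ : ∀ j < P.n, P.t j ≤ σ (j + 1) ∧ σ (j + 1) ≤ P.t (j + 1))
    (hσ' : ∀ j < P.n, P.t j ≤ σ' (j + 1) ∧ σ' (j + 1) ≤ P.t (j + 1)) :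
    ∑ j ∈ range P.n, |f (σ (j + 1)) - f (σ' (j + 1))| * (P.t (j + 1) - P.t j) < 2 * ε := by
  classical
  set u : ℕ → ℝ := fun k => if f (σ' k) ≤ f (σ k) then σ k else σ' k with hu_def
  set v : ℕ → ℝ := fun k => if f (σ' k) ≤ f (σ k) then σ' k else σ k with hv_def
  have hu : ∀ j < P.n, P.t j ≤ u (j + 1) ∧ u (j + 1) ≤ P.t (j + 1) := fun j hj => by
    simp only [hu_def]
    split_ifs
    exacts [hσ j hj, hσ' j hj]
  have hv : ∀ j < P.n, P.t j ≤ v (j + 1) ∧ v (j + 1) ≤ P.t (j + 1) := fun j hj => by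
    simp only [hv_def]
    split_ifs
    exacts [hσ' j hj, hσ j hj]
  have huv : ∀ k, |f (σ k) - f (σ' k)| = f (u k) - f (v k) := fun k => by
    simp only [hu_def, hv_def]
    split_ifs with h
    · exact abs_of_nonneg (sub_nonneg.mpr h)
    · rw [abs_sub_comm]
      exact abs_of_nonneg (sub_nonneg.mpr (le_of_lt (not_le.mp h)))
  have h1 := hI (P.retag u hu) hP
  have h2 := hI (P.retag v hv) hP
  set Su := (P.retag u hu).rsum f with hSu
  set Sv := (P.retag v hv).rsum f with hSv
  calc ∑ j ∈ range P.n, |f (σ (j + 1)) - f (σ' (j + 1))| * (P.t (j + 1) - P.t j)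
      = ∑ j ∈ range P.n, (f (u (j + 1)) - f (v (j + 1))) * (P.t (j + 1) - P.t j) :=
        Finset.sum_congr rfl fun j _ => by rw [huv]
    _ = Su - Sv := by
        rw [hSu, hSv, OSPartition.rsum, OSPartition.rsum]
        simp only [retag]
        rw [← Finset.sum_sub_distrib]
        exact Finset.sum_congr rfl fun j _ => by ring
    _ ≤ |Su - Sv| := le_abs_self _
    _ = |(I - Sv) - (I - Su)| := by ring_nf
    _ ≤ |I - Sv| + |I - Su| := abs_sub _ _
    _ < ε + ε := add_lt_add h2 h1
    _ = 2 * ε := by ring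

/-- The uniform partition of `[v, 1]` into `L` cells of length `w = (1 - v)/L`, with prescribed tags.
[cite: DavisRabinowitz1984, Sect. 1.6.8] -/
noncomputable def unif (v : ℝ) (hv0 : 0 < v) (hv1 : v < 1) (L : ℕ) (hL : 0 < L) (σ : ℕ → ℝ)
    (hσ : ∀ i < L, v + (i : ℝ) * ((1 - v) / L) ≤ σ (i + 1) ∧
      σ (i + 1) ≤ v + ((i + 1 : ℕ) : ℝ) * ((1 - v) / L)) : OSPartition where
  n := L
  t := fun i => v + (i : ℝ) * ((1 - v) / L)
  τ := σ
  t_zero_pos := by simpa using hv0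
  t_last := by
    have hL' : (L : ℝ) ≠ 0 := Nat.cast_ne_zero.mpr hL.ne'
    field_simp
    ring
  t_lt_succ := fun i hi => by
    have hw : 0 < (1 - v) / L := div_pos (by linarith) (Nat.cast_pos.mpr hL)
    push_cast
    nlinarith
  tag_mem := hσ

variable (v : ℝ) (hv0 : 0 < v) (hv1 : v < 1) (L : ℕ) (hL : 0 < L) (σ : ℕ → ℝ)
    (hσ : ∀ i < L, v + (i : ℝ) * ((1 - v) / L) ≤ σ (i + 1) ∧
      σ (i + 1) ≤ v + ((i + 1 : ℕ) : ℝ) * ((1 - v) / L))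

/-- The uniform partition is admissible for `(δ, χ)` when `v < χ` and its mesh is `< δ v`.
[cite: DavisRabinowitz1984, Sect. 1.6.8] -/
theorem unif_admissible {δ χ : ℝ} (hχ : v < χ) (hδ : (1 - v) / L < δ * v) :
    (unif v hv0 hv1 L hL σ hσ).Admissible δ χ := by
  have hw : 0 < (1 - v) / L := div_pos (by linarith) (Nat.cast_pos.mpr hL)
  refine ⟨by simpa [unif] using hχ, fun i hi => ?_⟩
  show 1 - δ < (v + (i : ℝ) * ((1 - v) / L)) / (v + ((i + 1 : ℕ) : ℝ) * ((1 - v) / L))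
  have hpos : 0 < v + ((i + 1 : ℕ) : ℝ) * ((1 - v) / L) := by positivity
  rw [lt_div_iff₀ hpos]
  push_cast
  have hi0 : (0 : ℝ) ≤ (i : ℝ) + 1 := by positivity
  have hδ0 : 0 < δ := by nlinarith
  nlinarith [mul_nonneg hδ0.le (mul_nonneg hi0 hw.le)]

/-- Its restricted Riemann sum: `Σ_{i<L} f(σ_{i+1}) w`. [cite: DavisRabinowitz1984, Sect. 1.6.8] -/
theorem unif_rsum (f : ℝ → ℝ) :
    (unif v hv0 hv1 L hL σ hσ).rsum f = ∑ i ∈ range L, f (σ (i + 1)) * ((1 - v) / L) := by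
  unfold rsum
  refine Finset.sum_congr rfl fun i _ => ?_
  simp only [unif]
  push_cast
  ring

/-- The points of the uniform partition. [cite: DavisRabinowitz1984, Sect. 1.6.8] -/
theorem unif_t (i : ℕ) : (unif v hv0 hv1 L hL σ hσ).t i = v + (i : ℝ) * ((1 - v) / L) := rfl

/-- The number of cells of the uniform partition. [cite: DavisRabinowitz1984, Sect. 1.6.8] -/
theorem unif_n : (unif v hv0 hv1 L hL σ hσ).n = L := rfl

end OSPartition

/-! ## An abstract squeeze criterion for Lebesgue integrability -/

/-- [folklore] If `f` is squeezed on `s` between measurable, integrable functions `φ_m ≤ f ≤ ψ_m` with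
`∫_s (ψ_m - φ_m) → 0`, then `f` is (a.e. equal to the measurable function `sup_m φ_m`, hence) integrable on `s`.
This is the classical "Riemann integrable ⇒ Lebesgue integrable" mechanism. -/
private theorem integrableOn_of_squeeze {α : Type*} [MeasurableSpace α] {μ : Measure α} {f : α → ℝ}
    {s : Set α} (hs : MeasurableSet s) (φ ψ : ℕ → α → ℝ) (hφm : ∀ m, Measurable (φ m))
    (hψm : ∀ m, Measurable (ψ m)) (hφi : ∀ m, IntegrableOn (φ m) s μ)
    (hψi : ∀ m, IntegrableOn (ψ m) s μ) (hle : ∀ m, ∀ x ∈ s, φ m x ≤ f x ∧ f x ≤ ψ m x)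
    (hint : ∀ m, ∫ x in s, (ψ m x - φ m x) ∂μ ≤ 1 / ((m : ℝ) + 1)) : IntegrableOn f s μ := by
  set g : α → ℝ := fun x => ⨆ m, φ m x with hg_def
  set G : α → ℝ := fun x => ⨅ m, ψ m x with hG_def
  have hgm : Measurable g := Measurable.iSup hφm
  have hGm : Measurable G := Measurable.iInf hψm
  have hbddA : ∀ x ∈ s, BddAbove (Set.range fun m => φ m x) := fun x hx =>
    ⟨f x, by rintro _ ⟨m, rfl⟩; exact (hle m x hx).1⟩
  have hbddB : ∀ x ∈ s, BddBelow (Set.range fun m => ψ m x) := fun x hx =>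
    ⟨f x, by rintro _ ⟨m, rfl⟩; exact (hle m x hx).2⟩
  have hφg : ∀ m, ∀ x ∈ s, φ m x ≤ g x := fun m x hx => le_ciSup (hbddA x hx) m
  have hgf : ∀ x ∈ s, g x ≤ f x := fun x hx => ciSup_le fun m => (hle m x hx).1
  have hGψ : ∀ m, ∀ x ∈ s, G x ≤ ψ m x := fun m x hx => ciInf_le (hbddB x hx) m
  have hfG : ∀ x ∈ s, f x ≤ G x := fun x hx => le_ciInf fun m => (hle m x hx).2
  -- the gap `D = G - g` has integral zero on `s`
  set D : α → ℝ := fun x => G x - g x with hD_def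
  have hD0 : ∀ x ∈ s, 0 ≤ D x := fun x hx => by
    simp only [hD_def]; linarith [hgf x hx, hfG x hx]
  have hDle : ∀ m, ∀ x ∈ s, D x ≤ ψ m x - φ m x := fun m x hx => by
    simp only [hD_def]; linarith [hφg m x hx, hGψ m x hx]
  have hDi : IntegrableOn D s μ := by
    refine Integrable.mono' ((hψi 0).sub (hφi 0)) (hGm.sub hgm).aestronglyMeasurable ?_
    refine ae_restrict_of_forall_mem hs fun x hx => ?_
    rw [Real.norm_of_nonneg (hD0 x hx)]
    exact hDle 0 x hx
  have hD_int_le : ∀ m : ℕ, ∫ x in s, D x ∂μ ≤ 1 / ((m : ℝ) + 1) := fun m =>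
    (setIntegral_mono_on hDi ((hψi m).sub (hφi m)) hs (hDle m)).trans (hint m)
  have hD_int : ∫ x in s, D x ∂μ = 0 := by
    refine le_antisymm ?_ (setIntegral_nonneg hs hD0)
    exact ge_of_tendsto' tendsto_one_div_add_atTop_nhds_zero_nat hD_int_le
  have hDae : D =ᵐ[μ.restrict s] 0 :=
    (setIntegral_eq_zero_iff_of_nonneg_ae (ae_restrict_of_forall_mem hs hD0) hDi).mp hD_int
  -- hence `f = g` a.e. on `s`
  have hfg : f =ᵐ[μ.restrict s] g := by
    filter_upwards [hDae, ae_restrict_mem hs] with x hx hxs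
    simp only [hD_def, Pi.zero_apply] at hx
    linarith [hgf x hxs, hfG x hxs]
  have hgi : IntegrableOn g s μ := by
    refine Integrable.mono' ((hφi 0).norm.add (hψi 0).norm) hgm.aestronglyMeasurable ?_
    refine ae_restrict_of_forall_mem hs fun x hx => ?_
    simp only [Pi.add_apply, Real.norm_eq_abs]
    have h1 := hφg 0 x hx
    have h2 := (hgf x hx).trans ((hfG x hx).trans (hGψ 0 x hx))
    rw [abs_le]
    constructor <;> linarith [neg_abs_le (φ 0 x), le_abs_self (ψ 0 x), abs_nonneg (φ 0 x),
      abs_nonneg (ψ 0 x)]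
  exact hgi.congr hfg.symm

/-! ## Uniform cells: suprema, infima and the oscillation sum -/

section UnifCells

variable {f : ℝ → ℝ} {I ε δ χ v : ℝ} {L : ℕ}

/-- On an admissible uniform partition of `[v, 1]`, `f` is bounded on every cell and the oscillation sum
`Σ_i (sup_{cell i} f - inf_{cell i} f) · w` is at most `2ε`. [cite: DavisRabinowitz1984, Sect. 1.6.8] -/
theorem unif_envelope (hP : ∀ Q : OSPartition, Q.Admissible δ χ → |I - Q.rsum f| < ε)
    (hv0 : 0 < v) (hv1 : v < 1) (hL : 0 < L) (hvχ : v < χ) (hmesh : (1 - v) / L < δ * v) :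
    ∃ M m : ℕ → ℝ,
      (∀ i < L, ∀ z ∈ Icc (v + (i : ℝ) * ((1 - v) / L)) (v + ((i + 1 : ℕ) : ℝ) * ((1 - v) / L)),
        m i ≤ f z ∧ f z ≤ M i) ∧
      ∑ i ∈ range L, (M i - m i) * ((1 - v) / L) ≤ 2 * ε := by
  classical
  set w : ℝ := (1 - v) / L with hw
  have hw0 : 0 < w := div_pos (by linarith) (Nat.cast_pos.mpr hL)
  set c : ℕ → ℝ := fun i => v + (i : ℝ) * w with hc
  have hc_le : ∀ i : ℕ, c i ≤ c (i + 1) := fun i => by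
    simp only [hc]; push_cast; nlinarith
  -- two tag families on the uniform partition
  have htwo : ∀ σ σ' : ℕ → ℝ,
      (hσ : ∀ i < L, v + (i : ℝ) * ((1 - v) / L) ≤ σ (i + 1) ∧
        σ (i + 1) ≤ v + ((i + 1 : ℕ) : ℝ) * ((1 - v) / L)) →
      (∀ i < L, v + (i : ℝ) * ((1 - v) / L) ≤ σ' (i + 1) ∧
        σ' (i + 1) ≤ v + ((i + 1 : ℕ) : ℝ) * ((1 - v) / L)) →
      ∑ i ∈ range L, |f (σ (i + 1)) - f (σ' (i + 1))| * w < 2 * ε := by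
    intro σ σ' hσ hσ'
    have key := (OSPartition.unif v hv0 hv1 L hL σ hσ).sum_abs_sub_mul_weight_lt hP
      (OSPartition.unif_admissible v hv0 hv1 L hL σ hσ hvχ hmesh) hσ hσ'
    have e : ∀ i, (OSPartition.unif v hv0 hv1 L hL σ hσ).t (i + 1) -
        (OSPartition.unif v hv0 hv1 L hL σ hσ).t i = w := by
      intro i
      simp only [OSPartition.unif_t]
      push_cast
      rw [hw]
      ring
    simp only [OSPartition.unif_n, e] at key
    exact key
  have hleft : ∀ i < L, v + (i : ℝ) * ((1 - v) / L) ≤ c i ∧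
      c i ≤ v + ((i + 1 : ℕ) : ℝ) * ((1 - v) / L) := fun i _ => ⟨le_rfl, hc_le i⟩
  -- boundedness on each cell
  have hbd : ∀ i < L, ∀ z ∈ Icc (c i) (c (i + 1)), |f z - f (c i)| * w < 2 * ε := by
    intro i hi z hz
    set σ : ℕ → ℝ := fun k => if k = i + 1 then z else c (k - 1) with hσ_def
    have hσ : ∀ j < L, v + (j : ℝ) * ((1 - v) / L) ≤ σ (j + 1) ∧
        σ (j + 1) ≤ v + ((j + 1 : ℕ) : ℝ) * ((1 - v) / L) := by
      intro j hj
      simp only [hσ_def, Nat.add_sub_cancel]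
      split_ifs with h
      · have hji : j = i := by omega
        subst hji
        exact hz
      · exact hleft j hj
    have h2 := htwo σ (fun k => c (k - 1)) hσ (fun j hj => by
      simp only [Nat.add_sub_cancel]; exact hleft j hj)
    have hterm : |f z - f (c i)| * w ≤ ∑ j ∈ range L, |f (σ (j + 1)) - f (c (j + 1 - 1))| * w := by
      have := Finset.single_le_sum (f := fun j => |f (σ (j + 1)) - f (c (j + 1 - 1))| * w)
        (fun j _ => mul_nonneg (abs_nonneg _) hw0.le) (mem_range.mpr hi)
      simpa [hσ_def] using this
    exact lt_of_le_of_lt hterm h2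
  have hne : ∀ i, (f '' Icc (c i) (c (i + 1))).Nonempty := fun i =>
    ⟨f (c i), c i, ⟨le_rfl, hc_le i⟩, rfl⟩
  have habove : ∀ i < L, BddAbove (f '' Icc (c i) (c (i + 1))) := fun i hi =>
    ⟨f (c i) + 2 * ε / w, by
      rintro _ ⟨z, hz, rfl⟩
      have h1 := hbd i hi z hz
      have h2 : |f z - f (c i)| < 2 * ε / w := by rw [lt_div_iff₀ hw0]; exact h1
      linarith [(abs_lt.mp h2).2]⟩
  have hbelow : ∀ i < L, BddBelow (f '' Icc (c i) (c (i + 1))) := fun i hi =>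
    ⟨f (c i) - 2 * ε / w, by
      rintro _ ⟨z, hz, rfl⟩
      have h1 := hbd i hi z hz
      have h2 : |f z - f (c i)| < 2 * ε / w := by rw [lt_div_iff₀ hw0]; exact h1
      linarith [(abs_lt.mp h2).1]⟩
  set M : ℕ → ℝ := fun i => sSup (f '' Icc (c i) (c (i + 1))) with hM
  set m : ℕ → ℝ := fun i => sInf (f '' Icc (c i) (c (i + 1))) with hm
  refine ⟨M, m, fun i hi z hz => ⟨csInf_le (hbelow i hi) (mem_image_of_mem f hz),
    le_csSup (habove i hi) (mem_image_of_mem f hz)⟩, ?_⟩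
  -- the oscillation sum
  refine le_of_forall_pos_lt_add fun η hη => ?_
  have hη2 : 0 < η / 2 := by positivity
  have hsup : ∀ i, ∃ z, (i < L → z ∈ Icc (c i) (c (i + 1)) ∧ M i - η / 2 < f z) := by
    intro i
    by_cases hi : i < L
    · obtain ⟨_, ⟨z, hz, rfl⟩, h⟩ := exists_lt_of_lt_csSup (hne i) (sub_lt_self (M i) hη2)
      exact ⟨z, fun _ => ⟨hz, h⟩⟩
    · exact ⟨0, fun h => absurd h hi⟩
  have hinf : ∀ i, ∃ z, (i < L → z ∈ Icc (c i) (c (i + 1)) ∧ f z < m i + η / 2) := by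
    intro i
    by_cases hi : i < L
    · obtain ⟨_, ⟨z, hz, rfl⟩, h⟩ := exists_lt_of_csInf_lt (hne i) (lt_add_of_pos_right (m i) hη2)
      exact ⟨z, fun _ => ⟨hz, h⟩⟩
    · exact ⟨0, fun h => absurd h hi⟩
  choose z hz using hsup
  choose z' hz' using hinf
  have h2 := htwo (fun k => z (k - 1)) (fun k => z' (k - 1))
    (fun j hj => by simp only [Nat.add_sub_cancel]; exact (hz j hj).1)
    (fun j hj => by simp only [Nat.add_sub_cancel]; exact (hz' j hj).1)
  simp only [Nat.add_sub_cancel] at h2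
  have hLw : (L : ℝ) * w = 1 - v := by
    rw [hw]; field_simp
  calc ∑ i ∈ range L, (M i - m i) * w
      ≤ ∑ i ∈ range L, (|f (z i) - f (z' i)| * w + η * w) := by
        refine Finset.sum_le_sum fun i hi => ?_
        have hi' := mem_range.mp hi
        have h1 := (hz i hi').2
        have h3 := (hz' i hi').2
        have h4 := le_abs_self (f (z i) - f (z' i))
        nlinarith
    _ = ∑ i ∈ range L, |f (z i) - f (z' i)| * w + η * (L * w) := by
        rw [Finset.sum_add_distrib, Finset.sum_const, card_range]
        simp
        ring
    _ < 2 * ε + η := by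
        rw [hLw]
        nlinarith

end UnifCells

/-! ## Statement (i): the dominated integral is the improper integral -/

/-- The `i`-th cell `(v + i w, v + (i+1) w]`, `w = (1 - v)/L`, of the uniform partition of `[v, 1]`.
[cite: DavisRabinowitz1984, Sect. 1.6.8] -/
abbrev unifCell (v : ℝ) (L i : ℕ) : Set ℝ :=
  Ioc (v + (i : ℝ) * ((1 - v) / L)) (v + ((i + 1 : ℕ) : ℝ) * ((1 - v) / L))


/-- **(i) of Davis–Rabinowitz Sect. 1.6.8** [Osgood–Shisha 1976, Thm 1]: if the dominated integral `I(f)` exists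
then `f` is (Lebesgue) integrable on every `[r, 1] ⊂ (0, 1]` and `∫_r^1 f → I(f)` as `r → 0⁺`. Proof: on an
admissible uniform partition of `[v, 1]` the definition bounds the oscillation sum `Σ (sup - inf) w` by `2ε`
(`unif_envelope`), so `f` is squeezed between step functions with `L¹`-close integrals — whence measurability and
integrability (`integrableOn_of_squeeze`, with `v` pushed below `min(r, χ_ε)`) — and, for `v < χ`, both `I` and
`∫_v^1 f` are within `ε`, `2ε` of the left-endpoint Riemann sum. [cite: DavisRabinowitz1984, Sect. 1.6.8] -/
theorem DominatedIntegralEqImproper_holds :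
    ∀ (f : ℝ → ℝ) (I : ℝ), DominatedIntegralEqImproper f I := by
  intro f I hI
  classical
  have hmeshL : ∀ {δ v : ℝ}, 0 < δ → 0 < v → v < 1 → ∃ L : ℕ, 0 < L ∧ (1 - v) / L < δ * v := by
    intro δ v hδ hv hv1
    obtain ⟨L, hL⟩ := exists_nat_gt ((1 - v) / (δ * v))
    refine ⟨L + 1, Nat.succ_pos L, ?_⟩
    have hδv : 0 < δ * v := mul_pos hδ hv
    rw [div_lt_iff₀ hδv] at hL
    rw [div_lt_iff₀ (by positivity)]
    push_cast
    nlinarith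
  -- cells of the uniform partition of `[v, 1]`: membership and evaluation of step functions
  have hcells : ∀ {v : ℝ} {L : ℕ}, 0 < v → v < 1 → 0 < L → ∀ x ∈ Ioc v 1, ∃ i < L,
      x ∈ unifCell v L i := by
    intro v L hv0 hv1 hL x hx
    simp only [unifCell, Set.mem_Ioc]
    set w := (1 - v) / L with hw
    have hw0 : 0 < w := div_pos (by linarith) (Nat.cast_pos.mpr hL)
    set y := (x - v) / w with hy
    have hy0 : 0 < y := div_pos (by linarith [hx.1]) hw0
    have hyL : y ≤ L := by
      rw [hy, div_le_iff₀ hw0, hw, mul_div_cancel₀ _ (Nat.cast_ne_zero.mpr hL.ne')]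
      linarith [hx.2]
    set k := ⌈y⌉₊ with hk
    have hk1 : 1 ≤ k := Nat.one_le_iff_ne_zero.mpr (Nat.pos_iff_ne_zero.mp (Nat.ceil_pos.mpr hy0))
    have hkL : k ≤ L := Nat.ceil_le.mpr hyL
    refine ⟨k - 1, by omega, ?_, ?_⟩
    · have h1 : ((k - 1 : ℕ) : ℝ) < y := Nat.lt_ceil.mp (by omega)
      have : ((k - 1 : ℕ) : ℝ) * w < x - v := by rwa [hy, lt_div_iff₀ hw0] at h1
      linarith
    · have h1 : y ≤ (k : ℝ) := Nat.le_ceil y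
      have hk' : ((k - 1 + 1 : ℕ) : ℝ) = (k : ℝ) := by
        rw [Nat.sub_add_cancel hk1]
      rw [hk']
      have : x - v ≤ (k : ℝ) * w := by rwa [hy, div_le_iff₀ hw0] at h1
      linarith
  have huniq : ∀ {v : ℝ} {L i j : ℕ} {x : ℝ}, 0 < (1 - v) / L →
      x ∈ unifCell v L i → x ∈ unifCell v L j → i = j := by
    intro v L i j x hw hi hj
    simp only [unifCell, Set.mem_Ioc] at hi hj
    by_contra hne
    rcases lt_or_gt_of_ne hne with h | h
    · have h' : ((i + 1 : ℕ) : ℝ) ≤ (j : ℝ) := by exact_mod_cast h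
      have := mul_le_mul_of_nonneg_right h' hw.le
      linarith [hi.2, hj.1]
    · have h' : ((j + 1 : ℕ) : ℝ) ≤ (i : ℝ) := by exact_mod_cast h
      have := mul_le_mul_of_nonneg_right h' hw.le
      linarith [hj.2, hi.1]
  have heval : ∀ {v : ℝ} {L : ℕ} (a : ℕ → ℝ) {x : ℝ} {i₀ : ℕ}, 0 < v → v < 1 → 0 < L → i₀ < L →
      x ∈ unifCell v L i₀ →
      ∑ i ∈ range L, (unifCell v L i).indicator (fun _ => a i) x = a i₀ := by
    intro v L a x i₀ hv0 hv1 hL hi₀ hx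
    have hw0 : 0 < (1 - v) / L := div_pos (by linarith) (Nat.cast_pos.mpr hL)
    rw [Finset.sum_eq_single_of_mem i₀ (mem_range.mpr hi₀) fun j _ hne => ?_]
    · exact indicator_of_mem hx _
    · exact indicator_of_notMem (fun hj => hne (huniq hw0 hj hx)) _
  -- integrability on `(r, 1]`
  have hInt : ∀ r ∈ Ioo (0 : ℝ) 1, IntegrableOn f (Ioc r 1) := by
    intro r hr
    have hstep : ∀ n : ℕ, ∃ φ ψ : ℝ → ℝ, Measurable φ ∧ Measurable ψ ∧ IntegrableOn φ (Ioc r 1) ∧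
        IntegrableOn ψ (Ioc r 1) ∧ (∀ x ∈ Ioc r 1, φ x ≤ f x ∧ f x ≤ ψ x) ∧
        ∫ x in Ioc r 1, (ψ x - φ x) ≤ 1 / ((n : ℝ) + 1) := by
      intro n
      have hεn : (0 : ℝ) < 1 / (2 * ((n : ℝ) + 1)) := by positivity
      obtain ⟨δ, χ, hδ, -, hχ, -, hP⟩ := hI _ hεn
      set v : ℝ := min r (χ / 2) with hv_def
      have hv0 : 0 < v := lt_min hr.1 (by linarith)
      have hvr : v ≤ r := min_le_left _ _
      have hvχ : v < χ := lt_of_le_of_lt (min_le_right _ _) (by linarith)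
      have hv1 : v < 1 := lt_of_le_of_lt hvr hr.2
      obtain ⟨L, hL, hmesh⟩ := hmeshL hδ hv0 hv1
      obtain ⟨M, mlo, hMm, hsum⟩ := unif_envelope hP hv0 hv1 hL hvχ hmesh
      have hw0 : 0 < (1 - v) / L := div_pos (by linarith) (Nat.cast_pos.mpr hL)
      have hEsub : ∀ i < L, unifCell v L i ⊆ Ioc v 1 := by
        intro i hi
        simp only [unifCell]
        refine Ioc_subset_Ioc (by nlinarith [hw0, (Nat.cast_nonneg i : (0:ℝ) ≤ i)]) ?_
        have h1 : ((i + 1 : ℕ) : ℝ) ≤ (L : ℝ) := by exact_mod_cast hi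
        have h2 : (L : ℝ) * ((1 - v) / L) = 1 - v := by field_simp
        nlinarith [mul_le_mul_of_nonneg_right h1 hw0.le]
      have hEcl : ∀ i, unifCell v L i ⊆
          Icc (v + (i : ℝ) * ((1 - v) / L)) (v + ((i + 1 : ℕ) : ℝ) * ((1 - v) / L)) := fun i =>
        Ioc_subset_Icc_self
      have hvol : volume (Ioc r 1) ≠ ⊤ := by simp
      have hint_ind : ∀ (a : ℕ → ℝ) (i : ℕ),
          IntegrableOn (fun x => (unifCell v L i).indicator (fun _ => a i) x) (Ioc r 1) := fun a i =>
        (integrableOn_const (C := a i) hvol).indicator measurableSet_Ioc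
      refine ⟨fun x => ∑ i ∈ range L, (unifCell v L i).indicator (fun _ => mlo i) x,
        fun x => ∑ i ∈ range L, (unifCell v L i).indicator (fun _ => M i) x,
        Finset.measurable_sum _ fun i _ => measurable_const.indicator measurableSet_Ioc,
        Finset.measurable_sum _ fun i _ => measurable_const.indicator measurableSet_Ioc,
        integrable_finsetSum _ fun i _ => hint_ind mlo i,
        integrable_finsetSum _ fun i _ => hint_ind M i, fun x hx => ?_, ?_⟩
      · -- pointwise squeeze on `(r, 1] ⊆ (v, 1]`
        have hx' : x ∈ Ioc v 1 := ⟨lt_of_le_of_lt hvr hx.1, hx.2⟩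
        obtain ⟨i₀, hi₀, hxi⟩ := hcells hv0 hv1 hL x hx'
        show (∑ i ∈ range L, (unifCell v L i).indicator (fun _ => mlo i) x) ≤ f x ∧
          f x ≤ ∑ i ∈ range L, (unifCell v L i).indicator (fun _ => M i) x
        rw [heval mlo hv0 hv1 hL hi₀ hxi, heval M hv0 hv1 hL hi₀ hxi]
        exact hMm i₀ hi₀ x (hEcl i₀ hxi)
      · -- the integral of the gap
        set θ : ℝ → ℝ := fun x => ∑ i ∈ range L, (unifCell v L i).indicator (fun _ => M i - mlo i) x
          with hθ
        have hθeq : ∀ x, (∑ i ∈ range L, (unifCell v L i).indicator (fun _ => M i) x) -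
            (∑ i ∈ range L, (unifCell v L i).indicator (fun _ => mlo i) x) = θ x := by
          intro x
          rw [hθ, ← Finset.sum_sub_distrib]
          refine Finset.sum_congr rfl fun i _ => ?_
          by_cases hxi : x ∈ unifCell v L i
          · rw [indicator_of_mem hxi, indicator_of_mem hxi, indicator_of_mem hxi]
          · rw [indicator_of_notMem hxi, indicator_of_notMem hxi, indicator_of_notMem hxi, sub_zero]
        have hθ0 : ∀ x, 0 ≤ θ x := by
          intro x
          refine Finset.sum_nonneg fun i hi => ?_
          by_cases hxi : x ∈ unifCell v L i
          · rw [indicator_of_mem hxi]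
            obtain ⟨h1, h2⟩ := hMm i (mem_range.mp hi) x (hEcl i hxi)
            linarith
          · rw [indicator_of_notMem hxi]
        have hθi : IntegrableOn θ (Ioc v 1) :=
          integrable_finsetSum _ fun i _ =>
            (integrableOn_const (C := M i - mlo i) (by simp)).indicator measurableSet_Ioc
        have hθint : ∫ x in Ioc v 1, θ x = ∑ i ∈ range L, (M i - mlo i) * ((1 - v) / L) := by
          rw [hθ, integral_finsetSum _ fun i _ =>
            (integrableOn_const (C := M i - mlo i) (by simp)).indicator measurableSet_Ioc]
          refine Finset.sum_congr rfl fun i hi => ?_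
          rw [setIntegral_indicator measurableSet_Ioc, inter_eq_right.mpr (hEsub i (mem_range.mp hi)),
            setIntegral_const, smul_eq_mul, Real.volume_real_Ioc_of_le (by push_cast; nlinarith)]
          push_cast
          ring
        calc ∫ x in Ioc r 1, ((∑ i ∈ range L, (unifCell v L i).indicator (fun _ => M i) x) -
              ∑ i ∈ range L, (unifCell v L i).indicator (fun _ => mlo i) x)
            = ∫ x in Ioc r 1, θ x := integral_congr_ae (Eventually.of_forall hθeq)
          _ ≤ ∫ x in Ioc v 1, θ x :=
              setIntegral_mono_set hθi (Eventually.of_forall hθ0)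
                (Ioc_subset_Ioc hvr le_rfl).eventuallyLE
          _ = ∑ i ∈ range L, (M i - mlo i) * ((1 - v) / L) := hθint
          _ ≤ 2 * (1 / (2 * ((n : ℝ) + 1))) := hsum
          _ = 1 / ((n : ℝ) + 1) := by field_simp
    choose φ ψ hφm hψm hφi hψi hle hint using hstep
    exact integrableOn_of_squeeze measurableSet_Ioc φ ψ hφm hψm hφi hψi hle hint
  refine ⟨fun r hr => (intervalIntegrable_iff_integrableOn_Ioc_of_le hr.2.le).mpr (hInt r hr), ?_⟩
  -- the limit
  rw [Metric.tendsto_nhdsWithin_nhds]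
  intro ε hε
  obtain ⟨δ, χ, hδ, -, hχ, hχ1, hP⟩ := hI (ε / 4) (by positivity)
  refine ⟨χ, hχ, fun {v} hv hvd => ?_⟩
  have hv0 : 0 < v := hv
  have hvχ : v < χ := by
    rw [Real.dist_eq, sub_zero, abs_of_pos hv0] at hvd
    exact hvd
  have hv1 : v < 1 := hvχ.trans hχ1
  obtain ⟨L, hL, hmesh⟩ := hmeshL hδ hv0 hv1
  obtain ⟨M, mlo, hMm, hsum⟩ := unif_envelope hP hv0 hv1 hL hvχ hmesh
  set w : ℝ := (1 - v) / L with hw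
  have hw0 : 0 < w := div_pos (by linarith) (Nat.cast_pos.mpr hL)
  set c : ℕ → ℝ := fun i => v + (i : ℝ) * w with hc
  have hc_succ : ∀ i : ℕ, c (i + 1) = c i + w := fun i => by
    simp only [hc]; push_cast; ring
  have hc_le : ∀ i : ℕ, c i ≤ c (i + 1) := fun i => by rw [hc_succ]; linarith
  have hc0 : c 0 = v := by simp [hc]
  have hcL : c L = 1 := by
    simp only [hc, hw]
    field_simp
    ring
  have hcv : ∀ i, v ≤ c i := fun i => by
    simp only [hc]; nlinarith [hw0, (Nat.cast_nonneg i : (0:ℝ) ≤ i)]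
  have hc1 : ∀ i ≤ L, c i ≤ 1 := by
    intro i hi
    have h1 : (i : ℝ) ≤ (L : ℝ) := by exact_mod_cast hi
    have := mul_le_mul_of_nonneg_right h1 hw0.le
    rw [← hcL]
    simp only [hc]
    linarith
  -- the left-endpoint Riemann sum is within `ε/4` of `I`
  have hleft : ∀ i < L, v + (i : ℝ) * ((1 - v) / L) ≤ c (i + 1 - 1) ∧
      c (i + 1 - 1) ≤ v + ((i + 1 : ℕ) : ℝ) * ((1 - v) / L) := fun i _ => by
    simp only [Nat.add_sub_cancel]
    exact ⟨le_rfl, hc_le i⟩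
  have hS := hP _ (OSPartition.unif_admissible v hv0 hv1 L hL (fun k => c (k - 1)) hleft hvχ hmesh)
  rw [OSPartition.unif_rsum] at hS
  simp only [Nat.add_sub_cancel] at hS
  -- `∫_v^1 f` is within `2 · ε/4` of the same sum
  have hfi : IntegrableOn f (Ioc v 1) := hInt v ⟨hv0, hv1⟩
  have hfii : ∀ i < L, IntervalIntegrable f volume (c i) (c (i + 1)) := by
    intro i hi
    rw [intervalIntegrable_iff_integrableOn_Ioc_of_le (hc_le i)]
    exact hfi.mono_set (Ioc_subset_Ioc (hcv i) (hc1 (i + 1) (Nat.succ_le_of_lt hi)))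
  have hsplit := intervalIntegral.sum_integral_adjacent_intervals (μ := volume) (f := f) (a := c)
    (n := L) hfii
  rw [hc0, hcL] at hsplit
  have hcell : ∀ i < L, |(∫ x in c i..c (i + 1), f x) - f (c i) * w| ≤ (M i - mlo i) * w := by
    intro i hi
    have e1 : f (c i) * w = ∫ x in c i..c (i + 1), f (c i) := by
      rw [intervalIntegral.integral_const, smul_eq_mul, hc_succ]; ring
    rw [e1, ← intervalIntegral.integral_sub (hfii i hi) intervalIntegrable_const]
    have hb : ∀ x ∈ Set.uIoc (c i) (c (i + 1)), ‖f x - f (c i)‖ ≤ M i - mlo i := by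
      intro x hx
      rw [Set.uIoc_of_le (hc_le i)] at hx
      have hxI : x ∈ Icc (v + (i : ℝ) * ((1 - v) / L)) (v + ((i + 1 : ℕ) : ℝ) * ((1 - v) / L)) :=
        ⟨hx.1.le, hx.2⟩
      have hcI : c i ∈ Icc (v + (i : ℝ) * ((1 - v) / L)) (v + ((i + 1 : ℕ) : ℝ) * ((1 - v) / L)) :=
        ⟨le_rfl, hc_le i⟩
      obtain ⟨h1, h2⟩ := hMm i hi x hxI
      obtain ⟨h3, h4⟩ := hMm i hi (c i) hcI
      rw [Real.norm_eq_abs, abs_le]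
      constructor <;> linarith
    have := intervalIntegral.norm_integral_le_of_norm_le_const hb
    have hcw : |c (i + 1) - c i| = w := by rw [hc_succ, add_sub_cancel_left, abs_of_pos hw0]
    rw [Real.norm_eq_abs, hcw] at this
    exact this
  have hdiff : |(∫ x in v..1, f x) - ∑ i ∈ range L, f (c i) * w| ≤ 2 * (ε / 4) := by
    rw [← hsplit, ← Finset.sum_sub_distrib]
    refine (Finset.abs_sum_le_sum_abs _ _).trans ?_
    exact (Finset.sum_le_sum fun i hi => hcell i (mem_range.mp hi)).trans hsum
  rw [Real.dist_eq]
  have hS' : |I - ∑ i ∈ range L, f (c i) * w| < ε / 4 := by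
    simpa only [hc, hw] using hS
  calc |(∫ x in v..1, f x) - I|
      = |((∫ x in v..1, f x) - ∑ i ∈ range L, f (c i) * w) - (I - ∑ i ∈ range L, f (c i) * w)| := by
        congr 1; ring
    _ ≤ |(∫ x in v..1, f x) - ∑ i ∈ range L, f (c i) * w| + |I - ∑ i ∈ range L, f (c i) * w| :=
        abs_sub _ _
    _ < 2 * (ε / 4) + ε / 4 := add_lt_add_of_le_of_lt hdiff hS'
    _ < ε := by linarith

end Literature.Analysis.Quadrature
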